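import Literature.Analysis.FluidPDE.TaoForcedFiniteEnergyLerayHopf
import HarnessLib

/-!
# Finite energy classical solutions of FORCED Navier–Stokes are Leray–Hopf — from the CORRECTED
# (a.e.) forced pressure normalisation alone (Tao 2011, Lemma 4.1 (i) a.e. form + §8 (61)–(65))

Cell `pub/ns-blowup`, seat `ns-blowup-ecbridge-2` g2 (PATH B of the `E–C` endpoint). WHAT THIS IS NOT:
not a statement about blow-up — regularity bookkeeping WITH force.

`TaoForcedFiniteEnergyLerayHopf.lean` packaged «smooth + finite energy ⇒ Leray–Hopf» conditionally on
the VERBATIM forced facts `tao2011_forced_pressure_normalisation` (Lemma 4.1 (i), "C bounded") and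
`tao2011_forced_finiteEnergy_energyBound` (Lemma 8.1). The first is REFUTED in the tree
(`not_tao2011_forced_pressure_normalisation`, `TaoForcedPressureNormalisationCounterexample.lean`:
the escaping shell, `C(t) = t^{-1/4}`), which makes those packagings vacuous (refuter K51). This file
re-does the whole chain on the CORRECTED fact `tao2011_forced_pressure_normalisation_ae` (measurable
`C`, a.e. representation, no bound — all that was ever used: the constant drops out against the
divergence-free velocity), and REMOVES the Lemma 8.1 hypothesis altogether by proving the finiteness
of the dissipation directly (Tao §8 (61)–(65) WITH the force terms kept, constants depending on the a
priori bound `A`):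

* `IsClassicalNSSolutionOn.energyEq_of_finiteEnergy_forced_ae` — the forced energy EQUALITY
  `½‖u(t)‖₂² + ν∫ₛᵗ∫|∇u|² = ½‖u(s)‖₂² + ∫ₛᵗ∫⟪f,u⟫` given `∇u ∈ L²_{t,x}`, `u ∈ L³_{t,x}`;
* `IsClassicalNSSolutionOn.localisedEnergy_le_forced` — `E_{θ⁸}(t) + (ν/2)∫₀ᵗX₁ ≤ ½∫|u₀|² + K T`
  uniformly in the cut-off radius (transport / viscous slices from `TaoEnergyLocalisationProofs`,
  pressure split `p̃[u] + Δ⁻¹∇·f + C(t)`, `p̃` by `X₅` at `ε = ν/4`, `Δ⁻¹∇·f` by Cauchy–Schwarz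
  against `|D(θ⁸)| ≤ 8C₁/r`, work of the force `≤ C_f^{1/2}A`);
* `IsClassicalNSSolutionOn.lintegral_gradient_lt_top_forced` — `∫₀ᵀ∫|∇u|² < ∞` (monotone
  convergence in `R`);
* `IsClassicalNSSolutionOn.isLerayHopfOn_of_finiteEnergy_forced_ae'` (core, with `∇u ∈ L²_{t,x}`
  as a hypothesis) and **`IsClassicalNSSolutionOn.isLerayHopfOn_of_finiteEnergy_forced_ae`**:
  `tao2011_forced_pressure_normalisation_ae →` (classical on `[0,T] × ℝ³`, `ν > 0`, force slices
  `∫|f(t)|² ≤ C_f`, force-potential slices `∫|Δ⁻¹∇·f(t)|² ≤ Π`, `sup_t ∫|u(t)|² < ∞`)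
  `→ IsLerayHopfOn T ν f (u 0) u ∧ ContinuousInLpOn (Icc 0 T) 2 u`. CONDITIONAL on the a.e. fact ONLY
  (the estimate of `X₅` is the tree's theorem `tao2011_pressureTerm_estimate_holds`).

## References

* T. Tao, *Localisation and compactness properties of the Navier–Stokes global regularity
  problem*, Anal. PDE 6 (2013) = arXiv:1108.1165 (`Tao2011`): Lemma 4.1 (i) and Remark 4.2
  (arXiv Lemma 25 (i), Remark 26: only `∇p` is used), p. 14; §8, proof of Lemma 8.1 (arXiv Lemma
  44), (54), (56), (58), (61)–(65), pp. 24–26.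
* J. Leray, Acta Math. 63 (1934) (`Leray1934`): §17 (3.4), §32.
* H. Sohr, *The Navier–Stokes Equations* (2001) (`Sohr2001`): Ch. V (1.5.3).
-/

noncomputable section

open MeasureTheory Set Filter Topology Metric
open scoped ENNReal NNReal RealInnerProductSpace

namespace Literature.Analysis.FluidPDE

/-! ## The forced energy equality from the a.e. normalisation -/

section Energy

variable {T ν : ℝ} {f u : ℝ → EuclideanSpace ℝ (Fin 3) → EuclideanSpace ℝ (Fin 3)}
  {p : ℝ → EuclideanSpace ℝ (Fin 3) → ℝ}

set_option maxHeartbeats 400000 in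
/-- **The energy equality for finite energy classical solutions WITH force** (Tao 2011, Lemma 8.1,
sharp form, with Lemma 4.1 (i); Leray 1934, (3.4); Sohr 2001, (1.5.3) with equality). Let `(u, p)`
be a classical solution of the forced system on `[0, T] × ℝ³` with `sup_t ∫|u(t)|² ≤ A < ⊤`,
`∇u ∈ L²_{t,x}`, `u ∈ L³_{t,x}`, force slices `∫|f(t)|² ≤ C_f < ⊤` and force-potential slices
`Δ⁻¹∇·f(t) ∈ L²` with `∫|Δ⁻¹∇·f(t)|² ≤ Π < ⊤`. Given Tao's forced pressure normalisation (Lemma 4.1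
(i) in its CORRECTED a.e. form `tao2011_forced_pressure_normalisation_ae`, `hP` — only the a.e.
representation is used, the constant `C(t)` dropping out) and the estimate of the pressure term `X₅`
(`hX5`, a theorem of the tree), for
`0 ≤ s ≤ t ≤ T`: `½‖u(t)‖₂² + ν∫ₛᵗ∫|∇u|² = ½‖u(s)‖₂² + ∫ₛᵗ∫⟪f, u⟫`.
[cite: Tao2011, Lemma 8.1 (proof, §8, (54), (61)–(65)) with Lemma 4.1 (i)] -/
theorem IsClassicalNSSolutionOn.energyEq_of_finiteEnergy_forced_ae
    (hP : tao2011_forced_pressure_normalisation_ae) (hX5 : tao2011_pressureTerm_estimate)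
    (h : IsClassicalNSSolutionOn (Icc 0 T) ν f u p) (hν : 0 < ν) (hT : 0 < T)
    {Cf : ℝ≥0∞} (hCft : Cf ≠ ⊤) (hCf : ∀ t ∈ Icc 0 T, ∫⁻ x, ‖f t x‖ₑ ^ 2 ≤ Cf)
    {Pf : ℝ≥0∞} (hPft : Pf ≠ ⊤)
    (hπm : ∀ t ∈ Icc 0 T, AEStronglyMeasurable (forcePotential (f t)) volume)
    (hπ : ∀ t ∈ Icc 0 T, ∫⁻ x, ‖forcePotential (f t) x‖ₑ ^ 2 ≤ Pf)
    {A : ℝ≥0∞} (hAt : A ≠ ⊤) (hA : ∀ t ∈ Icc 0 T, ∫⁻ x, ‖u t x‖ₑ ^ 2 ≤ A)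
    (hgrad : ∫⁻ τ in Ioo 0 T, ∫⁻ x, ENNReal.ofReal (frobeniusNormSq (fderiv ℝ (u τ) x)) < ⊤)
    (hu₃ : ∫⁻ τ in Ioo 0 T, ∫⁻ x, ‖u τ x‖ₑ ^ (3 : ℕ) < ⊤)
    {s t : ℝ} (hs : 0 ≤ s) (hst : s ≤ t) (ht : t ≤ T) :
    VectorCalculus.kineticEnergy (u t) +
      ν * (∫⁻ τ in Ioo s t, ∫⁻ x, ENNReal.ofReal (frobeniusNormSq (fderiv ℝ (u τ) x))).toReal =
      VectorCalculus.kineticEnergy (u s) + ∫ τ in Ioo s t, ∫ x, ⟪f τ x, u τ x⟫ := by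
  set b := stdOrthonormalBasis ℝ (EuclideanSpace ℝ (Fin 3))
  have hU : UniqueDiffOn ℝ (Icc 0 T) := uniqueDiffOn_Icc hT
  have htI : t ∈ Icc 0 T := ⟨hs.trans hst, ht⟩
  have hsI : s ∈ Icc 0 T := ⟨hs, hst.trans ht⟩
  have hIcc : ∀ {τ}, τ ∈ Ioo s t → τ ∈ Icc 0 T := fun hτ => ⟨hs.trans hτ.1.le, hτ.2.le.trans ht⟩
  have hmem : ∀ τ ∈ Icc 0 T, MemLp (u τ) 2 volume := fun τ hτ =>
    memLp_two_of_lintegral_lt_top (h.contDiff_velocity hτ).continuous ((hA τ hτ).trans_lt hAt.lt_top)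
  have hM : ∀ τ ∈ Icc 0 T, eEnergy (u τ) ≤ A := fun τ hτ => hA τ hτ
  have hfs : IsSmoothSpaceTimeOn (Icc 0 T) f := h.isSmoothSpaceTimeOn_force hU
  -- joint continuity on `[s, t] × E`
  have hsub : Icc s t ×ˢ (univ : Set (EuclideanSpace ℝ (Fin 3))) ⊆ Icc 0 T ×ˢ univ :=
    prod_mono (Icc_subset_Icc hs ht) Subset.rfl
  have cu : ContinuousOn (fun z : ℝ × EuclideanSpace ℝ (Fin 3) => u z.1 z.2) (Icc s t ×ˢ univ) :=
    h.smooth_velocity.continuousOn.mono hsub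
  have cDu : ContinuousOn (fun z : ℝ × EuclideanSpace ℝ (Fin 3) => fderiv ℝ (u z.1) z.2)
      (Icc s t ×ˢ univ) :=
    (h.smooth_velocity.fderiv_slice hU).continuousOn.mono hsub
  have cf : ContinuousOn (fun z : ℝ × EuclideanSpace ℝ (Fin 3) => f z.1 z.2) (Icc s t ×ˢ univ) :=
    (h.continuousOn_force hU).mono hsub
  -- the cut-offs
  obtain ⟨C, hC0', hfam⟩ := taoCutoff_family
  have hC0 : 0 ≤ C := hC0'.le
  have hRpos : ∀ n : ℕ, (0 : ℝ) < n + 1 := fun n => Nat.cast_add_one_pos n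
  set φ : ℕ → EuclideanSpace ℝ (Fin 3) → ℝ := fun n x =>
    taoCutoff (4 * ((n : ℝ) + 1)) ((n : ℝ) + 1) x ^ 8 with hφdef
  have hφ1 : ∀ n, ContDiff ℝ 1 (φ n) := fun n => (hfam n).1
  have hφc : ∀ n, HasCompactSupport (φ n) := fun n => (hfam n).2.1
  have hφle : ∀ n x, |φ n x| ≤ 1 := fun n => (hfam n).2.2.1
  have hφlim : ∀ x, Tendsto (fun n => φ n x) atTop (𝓝 1) := by
    intro x
    obtain ⟨N, hN⟩ := exists_nat_ge (‖x‖ / 3)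
    refine tendsto_atTop_of_eventually_const (i₀ := N) fun n hn => ?_
    refine (hfam n).2.2.2.1 x ?_
    have : (N : ℝ) ≤ n := by exact_mod_cast hn
    rw [div_le_iff₀ (by norm_num : (0 : ℝ) < 3)] at hN
    linarith
  have hDφv : ∀ n x v, |fderiv ℝ (φ n) x v| ≤ C / ((n : ℝ) + 1) * ‖v‖ := fun n => (hfam n).2.2.2.2
  have hc' : ∀ n : ℕ, (0 : ℝ) ≤ C / ((n : ℝ) + 1) := fun n => div_nonneg hC0 (hRpos n).le
  have hrate : ∀ K : ℝ, Tendsto (fun n : ℕ => K * (1 / ((n : ℝ) + 1))) atTop (𝓝 0) := fun K => by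
    simpa using (tendsto_one_div_add_atTop_nhds_zero_nat (𝕜 := ℝ)).const_mul K
  -- the identity for each `n`
  have hid := fun n => h.energy_balance_cutoff hT (hφ1 n) (hφc n) hs hst ht
  -- (a) the kinetic terms
  have limE : ∀ {r}, r ∈ Icc 0 T →
      Tendsto (fun n => 2⁻¹ * ∫ x, φ n x * ‖u r x‖ ^ 2) atTop
        (𝓝 (VectorCalculus.kineticEnergy (u r))) := by
    intro r hr
    have hur : Continuous (u r) := (h.contDiff_velocity hr).continuous
    refine Tendsto.const_mul _ (tendsto_integral_of_dominated_convergence (fun x => ‖u r x‖ ^ 2)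
      ?_ ((hmem r hr).integrable_norm_pow two_ne_zero) ?_ ?_)
    · exact fun n => ((hφ1 n).continuous.mul (hur.norm.pow 2)).aestronglyMeasurable
    · refine fun n => Eventually.of_forall fun x => ?_
      rw [Real.norm_eq_abs, abs_mul, abs_of_nonneg (sq_nonneg ‖u r x‖)]
      exact mul_le_of_le_one_left (sq_nonneg _) (hφle n x)
    · exact Eventually.of_forall fun x => by simpa using (hφlim x).mul_const (‖u r x‖ ^ 2)
  -- (b) the transported kinetic energy `½ ∫∫ (Dφ·u)|u|²` is `O(1/n)`
  have lim1 : Tendsto (fun n => ∫ τ in Ioo s t, ∫ x, fderiv ℝ (φ n) x (u τ x) * ‖u τ x‖ ^ 2)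
      atTop (𝓝 0) := by
    set L := ∫⁻ τ in Ioo 0 T, ∫⁻ x, ‖u τ x‖ₑ ^ (3 : ℕ) with hL
    have hLt : L ≠ ⊤ := hu₃.ne
    refine squeeze_zero_norm (a := fun n : ℕ => C * L.toReal * (1 / ((n : ℝ) + 1)))
      (fun n => ?_) (hrate _)
    have hpt : ∀ τ x, ‖fderiv ℝ (φ n) x (u τ x) * ‖u τ x‖ ^ 2‖ₑ ≤
        ENNReal.ofReal (C / ((n : ℝ) + 1)) * ‖u τ x‖ₑ ^ (3 : ℕ) := fun τ x => by
      rw [Real.enorm_eq_ofReal_abs, ← ofReal_norm, ← ENNReal.ofReal_pow (norm_nonneg _),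
        ← ENNReal.ofReal_mul (hc' n)]
      refine ENNReal.ofReal_le_ofReal ?_
      rw [abs_mul, abs_of_nonneg (sq_nonneg ‖u τ x‖)]
      calc |fderiv ℝ (φ n) x (u τ x)| * ‖u τ x‖ ^ 2
          ≤ C / ((n : ℝ) + 1) * ‖u τ x‖ * ‖u τ x‖ ^ 2 := by gcongr; exact hDφv n x _
        _ = C / ((n : ℝ) + 1) * ‖u τ x‖ ^ 3 := by ring
    have hle : ∫⁻ τ in Ioo s t, ∫⁻ x, ‖fderiv ℝ (φ n) x (u τ x) * ‖u τ x‖ ^ 2‖ₑ ≤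
        ENNReal.ofReal (C / ((n : ℝ) + 1)) * L := by
      calc ∫⁻ τ in Ioo s t, ∫⁻ x, ‖fderiv ℝ (φ n) x (u τ x) * ‖u τ x‖ ^ 2‖ₑ
          ≤ ∫⁻ τ in Ioo s t, ∫⁻ x, ENNReal.ofReal (C / ((n : ℝ) + 1)) * ‖u τ x‖ₑ ^ (3 : ℕ) :=
            lintegral_mono fun τ => lintegral_mono fun x => hpt τ x
        _ = ENNReal.ofReal (C / ((n : ℝ) + 1)) * ∫⁻ τ in Ioo s t, ∫⁻ x, ‖u τ x‖ₑ ^ (3 : ℕ) := by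
            simp only [lintegral_const_mul' _ _ ENNReal.ofReal_ne_top]
        _ ≤ ENNReal.ofReal (C / ((n : ℝ) + 1)) * L :=
            mul_le_mul_right (lintegral_Ioo_mono hs ht) _
    refine (norm_integral_integral_le_of_lintegral_le
      (G := fun z : ℝ × EuclideanSpace ℝ (Fin 3) => fderiv ℝ (φ n) z.2 (u z.1 z.2) * ‖u z.1 z.2‖ ^ 2)
      (ENNReal.mul_ne_top ENNReal.ofReal_ne_top hLt) hle).trans_eq ?_
    rw [ENNReal.toReal_mul, ENNReal.toReal_ofReal (hc' n)]
    ring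
  -- (c) the viscous cross term `ν ∫∫ Σᵢ ∂ᵢφ ⟪∂ᵢu, u⟫` is `O(1/n)` (Young's inequality)
  have lim3 : Tendsto (fun n => ∫ τ in Ioo s t, ∫ x, ∑ i, fderiv ℝ (φ n) x (b i) *
      ⟪fderiv ℝ (u τ) x (b i), u τ x⟫) atTop (𝓝 0) := by
    set Lg := ∫⁻ τ in Ioo 0 T, ∫⁻ x, ENNReal.ofReal (frobeniusNormSq (fderiv ℝ (u τ) x)) with hLg
    set d : ℕ := (Finset.univ : Finset (Fin (Module.finrank ℝ (EuclideanSpace ℝ (Fin 3))))).card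
      with hd
    set B : ℝ≥0∞ := Lg + (d : ℝ≥0∞) * A * ENNReal.ofReal T with hB
    have hBt : B ≠ ⊤ := ENNReal.add_ne_top.2 ⟨hgrad.ne, ENNReal.mul_ne_top
      (ENNReal.mul_ne_top (ENNReal.natCast_ne_top d) hAt) ENNReal.ofReal_ne_top⟩
    refine squeeze_zero_norm (a := fun n : ℕ => C * B.toReal * (1 / ((n : ℝ) + 1)))
      (fun n => ?_) (hrate _)
    -- pointwise Young bound
    have hpt : ∀ τ x, ‖∑ i, fderiv ℝ (φ n) x (b i) * ⟪fderiv ℝ (u τ) x (b i), u τ x⟫‖ₑ ≤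
        ENNReal.ofReal (C / ((n : ℝ) + 1)) *
          (ENNReal.ofReal (frobeniusNormSq (fderiv ℝ (u τ) x)) + d * ‖u τ x‖ₑ ^ 2) := by
      intro τ x
      have hreal : |∑ i, fderiv ℝ (φ n) x (b i) * ⟪fderiv ℝ (u τ) x (b i), u τ x⟫| ≤
          C / ((n : ℝ) + 1) * (frobeniusNormSq (fderiv ℝ (u τ) x) + d * ‖u τ x‖ ^ 2) := by
        calc |∑ i, fderiv ℝ (φ n) x (b i) * ⟪fderiv ℝ (u τ) x (b i), u τ x⟫|
            ≤ ∑ i, |fderiv ℝ (φ n) x (b i) * ⟪fderiv ℝ (u τ) x (b i), u τ x⟫| :=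
              Finset.abs_sum_le_sum_abs _ _
          _ ≤ ∑ i, C / ((n : ℝ) + 1) * (‖fderiv ℝ (u τ) x (b i)‖ ^ 2 + ‖u τ x‖ ^ 2) := by
              refine Finset.sum_le_sum fun i _ => ?_
              rw [abs_mul]
              have h1 : |fderiv ℝ (φ n) x (b i)| ≤ C / ((n : ℝ) + 1) := by
                simpa [b.orthonormal.1 i] using hDφv n x (b i)
              have h2 : |⟪fderiv ℝ (u τ) x (b i), u τ x⟫| ≤
                  ‖fderiv ℝ (u τ) x (b i)‖ ^ 2 + ‖u τ x‖ ^ 2 :=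
                (abs_real_inner_le_norm _ _).trans (by
                  nlinarith [sq_nonneg (‖fderiv ℝ (u τ) x (b i)‖ - ‖u τ x‖),
                    norm_nonneg (fderiv ℝ (u τ) x (b i)), norm_nonneg (u τ x)])
              exact mul_le_mul h1 h2 (abs_nonneg _) (hc' n)
          _ = C / ((n : ℝ) + 1) * (frobeniusNormSq (fderiv ℝ (u τ) x) + d * ‖u τ x‖ ^ 2) := by
              rw [← Finset.mul_sum, Finset.sum_add_distrib, Finset.sum_const, nsmul_eq_mul,
                frobeniusNormSq_eq_sum b]
      rw [Real.enorm_eq_ofReal_abs]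
      refine (ENNReal.ofReal_le_ofReal hreal).trans_eq ?_
      rw [ENNReal.ofReal_mul (hc' n), ENNReal.ofReal_add (frobeniusNormSq_nonneg _) (by positivity),
        ENNReal.ofReal_mul (Nat.cast_nonneg _), ENNReal.ofReal_natCast, ← ofReal_norm,
        ← ENNReal.ofReal_pow (norm_nonneg _)]
    -- inner integrals, `τ ∈ (s, t)`
    have hin : ∀ τ ∈ Ioo s t,
        ∫⁻ x, ‖∑ i, fderiv ℝ (φ n) x (b i) * ⟪fderiv ℝ (u τ) x (b i), u τ x⟫‖ₑ ≤
          ENNReal.ofReal (C / ((n : ℝ) + 1)) *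
            ((∫⁻ x, ENNReal.ofReal (frobeniusNormSq (fderiv ℝ (u τ) x))) + d * A) := by
      intro τ hτ
      have hτI := hIcc hτ
      have hmeas : AEMeasurable (fun x => ENNReal.ofReal (frobeniusNormSq (fderiv ℝ (u τ) x)))
          (volume : Measure (EuclideanSpace ℝ (Fin 3))) :=
        (ENNReal.continuous_ofReal.comp (LerayHopfProofs.continuous_frobeniusNormSq.comp
          ((h.contDiff_velocity hτI).continuous_fderiv (by simp)))).aemeasurable
      calc ∫⁻ x, ‖∑ i, fderiv ℝ (φ n) x (b i) * ⟪fderiv ℝ (u τ) x (b i), u τ x⟫‖ₑ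
          ≤ ∫⁻ x, ENNReal.ofReal (C / ((n : ℝ) + 1)) *
              (ENNReal.ofReal (frobeniusNormSq (fderiv ℝ (u τ) x)) + d * ‖u τ x‖ₑ ^ 2) :=
            lintegral_mono fun x => hpt τ x
        _ = ENNReal.ofReal (C / ((n : ℝ) + 1)) *
              ((∫⁻ x, ENNReal.ofReal (frobeniusNormSq (fderiv ℝ (u τ) x))) +
                d * ∫⁻ x, ‖u τ x‖ₑ ^ 2) := by
            rw [lintegral_const_mul' _ _ ENNReal.ofReal_ne_top, lintegral_add_left' hmeas,
              lintegral_const_mul' _ _ (ENNReal.natCast_ne_top d)]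
        _ ≤ ENNReal.ofReal (C / ((n : ℝ) + 1)) *
              ((∫⁻ x, ENNReal.ofReal (frobeniusNormSq (fderiv ℝ (u τ) x))) + d * A) := by
            gcongr
            exact hM τ hτI
    have hle : ∫⁻ τ in Ioo s t,
        ∫⁻ x, ‖∑ i, fderiv ℝ (φ n) x (b i) * ⟪fderiv ℝ (u τ) x (b i), u τ x⟫‖ₑ ≤
          ENNReal.ofReal (C / ((n : ℝ) + 1)) * B := by
      calc ∫⁻ τ in Ioo s t, ∫⁻ x, ‖∑ i, fderiv ℝ (φ n) x (b i) * ⟪fderiv ℝ (u τ) x (b i), u τ x⟫‖ₑ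
          ≤ ∫⁻ τ in Ioo s t, ENNReal.ofReal (C / ((n : ℝ) + 1)) *
              ((∫⁻ x, ENNReal.ofReal (frobeniusNormSq (fderiv ℝ (u τ) x))) + d * A) :=
            setLIntegral_mono' measurableSet_Ioo hin
        _ = ENNReal.ofReal (C / ((n : ℝ) + 1)) *
              ((∫⁻ τ in Ioo s t, ∫⁻ x, ENNReal.ofReal (frobeniusNormSq (fderiv ℝ (u τ) x))) +
                d * A * volume (Ioo s t)) := by
            rw [lintegral_const_mul' _ _ ENNReal.ofReal_ne_top, lintegral_add_right _ measurable_const,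
              setLIntegral_const]
        _ ≤ ENNReal.ofReal (C / ((n : ℝ) + 1)) * B := by
            rw [hB, Real.volume_Ioo]
            gcongr
            · exact lintegral_Ioo_mono hs ht
            · linarith
    refine (norm_integral_integral_le_of_lintegral_le
      (G := fun z : ℝ × EuclideanSpace ℝ (Fin 3) => ∑ i, fderiv ℝ (φ n) z.2 (b i) *
        ⟪fderiv ℝ (u z.1) z.2 (b i), u z.1 z.2⟫)
      (ENNReal.mul_ne_top ENNReal.ofReal_ne_top hBt) hle).trans_eq ?_
    rw [ENNReal.toReal_mul, ENNReal.toReal_ofReal (hc' n)]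
    ring
  -- (d) the pressure flux `∫∫ p (Dφ·u)`: Lemma 4.1 (i) WITH force, the estimate of `X₅`, and the
  -- `L²` bound of the force potential
  have lim4 : Tendsto (fun n => ∫ τ in Ioo s t, ∫ x, p τ x * fderiv ℝ (φ n) x (u τ x))
      atTop (𝓝 0) := by
    have hE' : ∃ C : ℝ≥0, ∀ τ ∈ Icc 0 T, ∫⁻ x, ‖u τ x‖ₑ ^ 2 ≤ C :=
      ⟨A.toNNReal, fun τ hτ => (hA τ hτ).trans (ENNReal.coe_toNNReal hAt).ge⟩
    obtain ⟨Cp, -, hae⟩ := hP hν hT h hfs (lintegral_sqrt_force_lt_top hCft hCf) hE'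
    obtain ⟨C₅, hC₅0, h5⟩ := hX5
    set Ar : ℝ := Real.sqrt A.toReal with hAr
    have hAr0 : 0 ≤ Ar := Real.sqrt_nonneg _
    have hAr2 : ENNReal.ofReal (Ar ^ 2) = A := by
      rw [hAr, Real.sq_sqrt ENNReal.toReal_nonneg, ENNReal.ofReal_toReal hAt]
    -- the new constant `Π^{1/2} A^{1/2}` of the force-potential term
    set PA : ℝ≥0∞ := Pf ^ (1 / 2 : ℝ) * A ^ (1 / 2 : ℝ) with hPA
    have hPAt : PA ≠ ⊤ := ENNReal.mul_ne_top (ENNReal.rpow_ne_top_of_nonneg (by norm_num) hPft)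
      (ENNReal.rpow_ne_top_of_nonneg (by norm_num) hAt)
    set G : ℝ → ℝ≥0∞ := fun τ => ∫⁻ x, ENNReal.ofReal (frobeniusNormSq (fderiv ℝ (u τ) x)) with hG
    set Dst : ℝ≥0∞ := ∫⁻ τ in Ioo s t, G τ with hDst
    have hDst : Dst ≠ ⊤ := ((lintegral_Ioo_mono hs ht).trans_lt hgrad).ne
    -- the slice bound, for a.e. `τ ∈ (s, t)` and every `ε > 0`, `n`
    have hae' : ∀ᵐ τ ∂(volume.restrict (Ioo s t)), ∀ x,
        p τ x = normalisedPressure (u τ) x + forcePotential (f τ) x + Cp τ :=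
      ae_restrict_of_ae_restrict_of_subset (Ioo_subset_Icc_self.trans (Icc_subset_Icc hs ht)) hae
    have hslice : ∀ {ε : ℝ} (_ : 0 < ε) (n : ℕ), ∀ᵐ τ ∂(volume.restrict (Ioo s t)),
        ‖∫ x, p τ x * fderiv ℝ (φ n) x (u τ x)‖ₑ ≤
          ENNReal.ofReal ε * G τ +
            ENNReal.ofReal (C₅ * (ε * Ar ^ 2 / ((n : ℝ) + 1) ^ 2 + Ar ^ 6 / (ε ^ 3 * ((n : ℝ) + 1) ^ 4)) +
              C / ((n : ℝ) + 1) * PA.toReal) := by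
      intro ε hε n
      filter_upwards [hae', ae_restrict_mem measurableSet_Ioo] with τ hτ hτm
      have hτI := hIcc hτm
      have hv := h.contDiff_velocity hτI
      have hv1 : ContDiff ℝ 1 (u τ) := hv.of_le (by norm_cast)
      -- the force-potential pairing is integrable and small
      have hw : ∀ x, |fderiv ℝ (φ n) x (u τ x)| ≤ C / ((n : ℝ) + 1) * ‖u τ x‖ := fun x => hDφv n x _
      have hD : Continuous fun x => fderiv ℝ (φ n) x (u τ x) :=
        ((hφ1 n).continuous_fderiv one_ne_zero).clm_apply hv.continuous
      have hπle := lintegral_enorm_potential_mul_le (hπm τ hτI) hv.continuous (hπ τ hτI) (hA τ hτI)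
        (hc' n) hw
      have hπi : Integrable fun x => forcePotential (f τ) x * fderiv ℝ (φ n) x (u τ x) :=
        ⟨(hπm τ hτI).mul hD.aestronglyMeasurable,
          hπle.trans_lt (ENNReal.mul_lt_top ENNReal.ofReal_lt_top hPAt.lt_top)⟩
      have heq := integral_forcedPressure_shift_eq hv1 (h.divFree τ hτI) (hφ1 n) (hφc n)
        (h.contDiff_pressure hτI).continuous hπi hτ
      have hr : (0 : ℝ) < (n : ℝ) + 1 := hRpos n
      have h5' := h5 (u τ) hv Ar hAr0 (by rw [hAr2]; exact hA τ hτI) (4 * ((n : ℝ) + 1)) ((n : ℝ) + 1)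
        hr (by linarith) ε hε
      have h5'' : |∫ x, normalisedPressure (u τ) x * fderiv ℝ (φ n) x (u τ x)| ≤
          ε * localisedDissipation (φ n) (u τ) +
            C₅ * (ε * Ar ^ 2 / ((n : ℝ) + 1) ^ 2 + Ar ^ 6 / (ε ^ 3 * ((n : ℝ) + 1) ^ 4)) := h5'
      have hX : ENNReal.ofReal (localisedDissipation (φ n) (u τ)) ≤ G τ :=
        ofReal_localisedDissipation_le hv1 (hφ1 n).continuous (hφc n)
          (fun x => taoCutoff_pow_nonneg _ _ x 8) (fun x => taoCutoff_pow_le_one _ _ x 8)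
      have hX0 : 0 ≤ ε * localisedDissipation (φ n) (u τ) :=
        mul_nonneg hε.le (localisedDissipation_nonneg (fun x => taoCutoff_pow_nonneg _ _ x 8) _)
      rw [heq]
      refine (enorm_add_le _ _).trans ?_
      have hA1 : ‖∫ x, normalisedPressure (u τ) x * fderiv ℝ (φ n) x (u τ x)‖ₑ ≤
          ENNReal.ofReal ε * G τ +
            ENNReal.ofReal (C₅ * (ε * Ar ^ 2 / ((n : ℝ) + 1) ^ 2 + Ar ^ 6 / (ε ^ 3 * ((n : ℝ) + 1) ^ 4))) := by
        rw [Real.enorm_eq_ofReal_abs]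
        refine (ENNReal.ofReal_le_ofReal h5'').trans ?_
        rw [ENNReal.ofReal_add hX0 (by positivity), ENNReal.ofReal_mul hε.le]
        gcongr
      have hA2 : ‖∫ x, forcePotential (f τ) x * fderiv ℝ (φ n) x (u τ x)‖ₑ ≤
          ENNReal.ofReal (C / ((n : ℝ) + 1) * PA.toReal) := by
        refine (enorm_integral_le_lintegral_enorm _).trans (hπle.trans_eq ?_)
        rw [ENNReal.ofReal_mul (hc' n), ENNReal.ofReal_toReal hPAt]
      calc ‖∫ x, normalisedPressure (u τ) x * fderiv ℝ (φ n) x (u τ x)‖ₑ +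
            ‖∫ x, forcePotential (f τ) x * fderiv ℝ (φ n) x (u τ x)‖ₑ
          ≤ (ENNReal.ofReal ε * G τ +
              ENNReal.ofReal (C₅ * (ε * Ar ^ 2 / ((n : ℝ) + 1) ^ 2 + Ar ^ 6 / (ε ^ 3 * ((n : ℝ) + 1) ^ 4)))) +
              ENNReal.ofReal (C / ((n : ℝ) + 1) * PA.toReal) := add_le_add hA1 hA2
        _ = ENNReal.ofReal ε * G τ +
            ENNReal.ofReal (C₅ * (ε * Ar ^ 2 / ((n : ℝ) + 1) ^ 2 + Ar ^ 6 / (ε ^ 3 * ((n : ℝ) + 1) ^ 4)) +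
              C / ((n : ℝ) + 1) * PA.toReal) := by
            rw [add_assoc, ← ENNReal.ofReal_add (by positivity)
              (mul_nonneg (hc' n) ENNReal.toReal_nonneg)]
    -- hence the bound on the time integral
    have hbound : ∀ {ε : ℝ} (_ : 0 < ε) (n : ℕ),
        |∫ τ in Ioo s t, ∫ x, p τ x * fderiv ℝ (φ n) x (u τ x)| ≤
          ε * Dst.toReal +
            (C₅ * (ε * Ar ^ 2 / ((n : ℝ) + 1) ^ 2 + Ar ^ 6 / (ε ^ 3 * ((n : ℝ) + 1) ^ 4)) +
              C / ((n : ℝ) + 1) * PA.toReal) * (t - s) := by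
      intro ε hε n
      set K₂ : ℝ := C₅ * (ε * Ar ^ 2 / ((n : ℝ) + 1) ^ 2 + Ar ^ 6 / (ε ^ 3 * ((n : ℝ) + 1) ^ 4)) +
        C / ((n : ℝ) + 1) * PA.toReal with hK₂
      have hK₂0 : 0 ≤ K₂ := add_nonneg (by positivity) (mul_nonneg (hc' n) ENNReal.toReal_nonneg)
      have hle : ∫⁻ τ in Ioo s t, ‖∫ x, p τ x * fderiv ℝ (φ n) x (u τ x)‖ₑ ≤
          ENNReal.ofReal ε * Dst + ENNReal.ofReal K₂ * volume (Ioo s t) := by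
        calc ∫⁻ τ in Ioo s t, ‖∫ x, p τ x * fderiv ℝ (φ n) x (u τ x)‖ₑ
            ≤ ∫⁻ τ in Ioo s t, (ENNReal.ofReal ε * G τ + ENNReal.ofReal K₂) :=
              lintegral_mono_ae (hslice hε n)
          _ = ENNReal.ofReal ε * Dst + ENNReal.ofReal K₂ * volume (Ioo s t) := by
              rw [lintegral_add_right _ measurable_const, lintegral_const_mul' _ _ ENNReal.ofReal_ne_top,
                setLIntegral_const]
      have hfin : ENNReal.ofReal ε * Dst + ENNReal.ofReal K₂ * volume (Ioo s t) ≠ ⊤ := by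
        rw [Real.volume_Ioo]
        exact ENNReal.add_ne_top.2 ⟨ENNReal.mul_ne_top ENNReal.ofReal_ne_top hDst,
          ENNReal.mul_ne_top ENNReal.ofReal_ne_top ENNReal.ofReal_ne_top⟩
      have h1 : ‖∫ τ in Ioo s t, ∫ x, p τ x * fderiv ℝ (φ n) x (u τ x)‖ ≤
          (ENNReal.ofReal ε * Dst + ENNReal.ofReal K₂ * volume (Ioo s t)).toReal := by
        refine (norm_integral_le_lintegral_norm _).trans (ENNReal.toReal_mono hfin ?_)
        refine le_trans (lintegral_mono fun τ => ?_) hle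
        rw [ofReal_norm]
      rw [Real.norm_eq_abs] at h1
      refine h1.trans_eq ?_
      rw [Real.volume_Ioo, ENNReal.toReal_add (ENNReal.mul_ne_top ENNReal.ofReal_ne_top hDst)
        (ENNReal.mul_ne_top ENNReal.ofReal_ne_top ENNReal.ofReal_ne_top), ENNReal.toReal_mul,
        ENNReal.toReal_mul, ENNReal.toReal_ofReal hε.le, ENNReal.toReal_ofReal hK₂0,
        ENNReal.toReal_ofReal (by linarith)]
    -- and the limit
    rw [Metric.tendsto_nhds]
    intro δ hδ
    set ε : ℝ := δ / (2 * (Dst.toReal + 1)) with hεdef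
    have hD0 : 0 ≤ Dst.toReal := ENNReal.toReal_nonneg
    have hε : 0 < ε := by positivity
    have hεD : ε * Dst.toReal ≤ δ / 2 := by
      rw [hεdef, div_mul_eq_mul_div, div_le_iff₀ (by positivity)]
      nlinarith
    have hsecond : Tendsto (fun n : ℕ =>
        (C₅ * (ε * Ar ^ 2 / ((n : ℝ) + 1) ^ 2 + Ar ^ 6 / (ε ^ 3 * ((n : ℝ) + 1) ^ 4)) +
          C / ((n : ℝ) + 1) * PA.toReal) * (t - s))
        atTop (𝓝 0) := by
      have h0 : Tendsto (fun n : ℕ => (1 : ℝ) / ((n : ℝ) + 1)) atTop (𝓝 0) :=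
        tendsto_one_div_add_atTop_nhds_zero_nat
      have e : ∀ n : ℕ, (C₅ * (ε * Ar ^ 2 / ((n : ℝ) + 1) ^ 2 + Ar ^ 6 / (ε ^ 3 * ((n : ℝ) + 1) ^ 4)) +
          C / ((n : ℝ) + 1) * PA.toReal) * (t - s) =
          (C₅ * (ε * Ar ^ 2 * (1 / ((n : ℝ) + 1)) ^ 2 + Ar ^ 6 / ε ^ 3 * (1 / ((n : ℝ) + 1)) ^ 4) +
            C * PA.toReal * (1 / ((n : ℝ) + 1))) * (t - s) := by
        intro n
        have : (n : ℝ) + 1 ≠ 0 := (hRpos n).ne'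
        field_simp
      simp_rw [e]
      have := (((((h0.pow 2).const_mul (ε * Ar ^ 2)).add ((h0.pow 4).const_mul (Ar ^ 6 / ε ^ 3))).const_mul
        C₅).add (h0.const_mul (C * PA.toReal))).mul_const (t - s)
      simpa using this
    have hev : ∀ᶠ n : ℕ in atTop,
        |(C₅ * (ε * Ar ^ 2 / ((n : ℝ) + 1) ^ 2 + Ar ^ 6 / (ε ^ 3 * ((n : ℝ) + 1) ^ 4)) +
          C / ((n : ℝ) + 1) * PA.toReal) * (t - s)| < δ / 2 := by
      have h2 := hsecond
      rw [Metric.tendsto_nhds] at h2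
      simpa only [dist_zero_right, Real.norm_eq_abs] using h2 (δ / 2) (half_pos hδ)
    filter_upwards [hev] with n hn
    rw [dist_zero_right, Real.norm_eq_abs]
    calc |∫ τ in Ioo s t, ∫ x, p τ x * fderiv ℝ (φ n) x (u τ x)|
        ≤ ε * Dst.toReal +
            (C₅ * (ε * Ar ^ 2 / ((n : ℝ) + 1) ^ 2 + Ar ^ 6 / (ε ^ 3 * ((n : ℝ) + 1) ^ 4)) +
              C / ((n : ℝ) + 1) * PA.toReal) * (t - s) := hbound hε n
      _ < δ := by
          linarith [le_abs_self ((C₅ * (ε * Ar ^ 2 / ((n : ℝ) + 1) ^ 2 +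
            Ar ^ 6 / (ε ^ 3 * ((n : ℝ) + 1) ^ 4)) + C / ((n : ℝ) + 1) * PA.toReal) * (t - s))]
  -- (e) the dissipation `ν ∫∫ φ |∇u|² → ν ∫∫ |∇u|²` (dominated convergence on `(s, t) × ℝ³`)
  set μ : Measure (ℝ × EuclideanSpace ℝ (Fin 3)) :=
    ((volume : Measure ℝ).restrict (Ioo s t)).prod (volume : Measure (EuclideanSpace ℝ (Fin 3)))
    with hμ
  have lim2 : Tendsto (fun n => ∫ τ in Ioo s t, ∫ x, φ n x * frobeniusNormSq (fderiv ℝ (u τ) x))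
      atTop (𝓝 ((∫⁻ τ in Ioo s t, ∫⁻ x,
        ENNReal.ofReal (frobeniusNormSq (fderiv ℝ (u τ) x))).toReal)) := by
    have cG : ContinuousOn (fun z : ℝ × EuclideanSpace ℝ (Fin 3) =>
        frobeniusNormSq (fderiv ℝ (u z.1) z.2)) (Icc s t ×ˢ univ) :=
      LerayHopfProofs.continuous_frobeniusNormSq.comp_continuousOn cDu
    have hGi : Integrable (fun z : ℝ × EuclideanSpace ℝ (Fin 3) =>
        frobeniusNormSq (fderiv ℝ (u z.1) z.2)) μ := by
      refine integrable_prod_of_continuousOn_of_lintegral cG ?_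
      calc ∫⁻ τ in Ioo s t, ∫⁻ x, ‖frobeniusNormSq (fderiv ℝ (u τ) x)‖ₑ
          = ∫⁻ τ in Ioo s t, ∫⁻ x, ENNReal.ofReal (frobeniusNormSq (fderiv ℝ (u τ) x)) := by
            simp only [Real.enorm_eq_ofReal (frobeniusNormSq_nonneg _)]
        _ ≤ ∫⁻ τ in Ioo 0 T, ∫⁻ x, ENNReal.ofReal (frobeniusNormSq (fderiv ℝ (u τ) x)) :=
            lintegral_Ioo_mono hs ht
        _ < ⊤ := hgrad
    have hFn : ∀ n, Integrable (fun z : ℝ × EuclideanSpace ℝ (Fin 3) =>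
        φ n z.2 * frobeniusNormSq (fderiv ℝ (u z.1) z.2)) μ := fun n =>
      hGi.mono' (aestronglyMeasurable_prod_of_continuousOn
        ((((hφ1 n).continuous.comp continuous_snd).continuousOn).mul cG))
        (Eventually.of_forall fun z => by
          rw [norm_mul, Real.norm_eq_abs, Real.norm_of_nonneg (frobeniusNormSq_nonneg _)]
          exact mul_le_of_le_one_left (frobeniusNormSq_nonneg _) (hφle n _))
    have hval : ∀ n, ∫ τ in Ioo s t, ∫ x, φ n x * frobeniusNormSq (fderiv ℝ (u τ) x) =
        ∫ z, φ n z.2 * frobeniusNormSq (fderiv ℝ (u z.1) z.2) ∂μ := fun n =>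
      (integral_prod _ (hFn n)).symm
    have hlimval : (∫⁻ τ in Ioo s t, ∫⁻ x, ENNReal.ofReal (frobeniusNormSq (fderiv ℝ (u τ) x))).toReal
        = ∫ z, frobeniusNormSq (fderiv ℝ (u z.1) z.2) ∂μ := by
      rw [integral_eq_lintegral_of_nonneg_ae (Eventually.of_forall fun z => frobeniusNormSq_nonneg _)
        hGi.aestronglyMeasurable, lintegral_prod _ hGi.aestronglyMeasurable.aemeasurable.ennreal_ofReal]
    rw [hlimval]
    refine (tendsto_integral_of_dominated_convergence
      (fun z : ℝ × EuclideanSpace ℝ (Fin 3) => frobeniusNormSq (fderiv ℝ (u z.1) z.2))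
      (fun n => (hFn n).aestronglyMeasurable) hGi (fun n => Eventually.of_forall fun z => ?_)
      (Eventually.of_forall fun z => ?_)).congr fun n => (hval n).symm
    · rw [norm_mul, Real.norm_eq_abs, Real.norm_of_nonneg (frobeniusNormSq_nonneg _)]
      exact mul_le_of_le_one_left (frobeniusNormSq_nonneg _) (hφle n _)
    · simpa using (hφlim z.2).mul_const (frobeniusNormSq (fderiv ℝ (u z.1) z.2))
  -- (f) the force term `∫∫ φ ⟪f, u⟫ → ∫∫ ⟪f, u⟫` (dominated convergence on `(s, t) × ℝ³`)
  have lim5 : Tendsto (fun n => ∫ τ in Ioo s t, ∫ x, φ n x * ⟪f τ x, u τ x⟫)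
      atTop (𝓝 (∫ τ in Ioo s t, ∫ x, ⟪f τ x, u τ x⟫)) := by
    have cF : ContinuousOn (fun z : ℝ × EuclideanSpace ℝ (Fin 3) => ⟪f z.1 z.2, u z.1 z.2⟫)
        (Icc s t ×ˢ univ) := cf.inner cu
    set CA : ℝ≥0∞ := Cf ^ (1 / 2 : ℝ) * A ^ (1 / 2 : ℝ) with hCA
    have hCAt : CA ≠ ⊤ := ENNReal.mul_ne_top (ENNReal.rpow_ne_top_of_nonneg (by norm_num) hCft)
      (ENNReal.rpow_ne_top_of_nonneg (by norm_num) hAt)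
    have hFi : Integrable (fun z : ℝ × EuclideanSpace ℝ (Fin 3) => ⟪f z.1 z.2, u z.1 z.2⟫) μ := by
      refine integrable_prod_of_continuousOn_of_lintegral cF ?_
      calc ∫⁻ τ in Ioo s t, ∫⁻ x, ‖⟪f τ x, u τ x⟫‖ₑ
          ≤ ∫⁻ τ in Ioo s t, ∫⁻ x, ‖f τ x‖ₑ * ‖u τ x‖ₑ := by
            refine lintegral_mono fun τ => lintegral_mono fun x => ?_
            rw [← ofReal_norm, ← ofReal_norm, ← ofReal_norm, ← ENNReal.ofReal_mul (norm_nonneg _)]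
            exact ENNReal.ofReal_le_ofReal (norm_inner_le_norm _ _)
        _ ≤ ∫⁻ τ in Ioo s t, CA := by
            refine setLIntegral_mono' measurableSet_Ioo fun τ hτ => ?_
            have hτI := hIcc hτ
            exact lintegral_enorm_force_mul_enorm_le (h.continuous_force_slice hU hτI)
              (h.contDiff_velocity hτI).continuous (hCf τ hτI) (hA τ hτI)
        _ = CA * volume (Ioo s t) := setLIntegral_const _ _
        _ < ⊤ := by
            rw [Real.volume_Ioo]; exact ENNReal.mul_lt_top hCAt.lt_top ENNReal.ofReal_lt_top
    have hFn : ∀ n, Integrable (fun z : ℝ × EuclideanSpace ℝ (Fin 3) =>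
        φ n z.2 * ⟪f z.1 z.2, u z.1 z.2⟫) μ := fun n =>
      hFi.norm.mono' (aestronglyMeasurable_prod_of_continuousOn
        ((((hφ1 n).continuous.comp continuous_snd).continuousOn).mul cF))
        (Eventually.of_forall fun z => by
          rw [norm_mul, Real.norm_eq_abs, Real.norm_eq_abs]
          exact mul_le_of_le_one_left (abs_nonneg _) (hφle n _))
    have hval : ∀ n, ∫ τ in Ioo s t, ∫ x, φ n x * ⟪f τ x, u τ x⟫ =
        ∫ z, φ n z.2 * ⟪f z.1 z.2, u z.1 z.2⟫ ∂μ := fun n => (integral_prod _ (hFn n)).symm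
    have hlimval : ∫ τ in Ioo s t, ∫ x, ⟪f τ x, u τ x⟫ = ∫ z, ⟪f z.1 z.2, u z.1 z.2⟫ ∂μ :=
      (integral_prod _ hFi).symm
    rw [hlimval]
    refine (tendsto_integral_of_dominated_convergence
      (fun z : ℝ × EuclideanSpace ℝ (Fin 3) => ‖⟪f z.1 z.2, u z.1 z.2⟫‖)
      (fun n => (hFn n).aestronglyMeasurable) hFi.norm (fun n => Eventually.of_forall fun z => ?_)
      (Eventually.of_forall fun z => ?_)).congr fun n => (hval n).symm
    · rw [norm_mul, Real.norm_eq_abs, Real.norm_eq_abs]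
      exact mul_le_of_le_one_left (abs_nonneg _) (hφle n _)
    · simpa using (hφlim z.2).mul_const (⟪f z.1 z.2, u z.1 z.2⟫)
  -- (g) pass to the limit in the identity
  have hLHS := (limE htI).sub (limE hsI)
  have hRHS := ((((lim1.const_mul (2⁻¹ : ℝ)).sub (lim2.const_mul ν)).sub (lim3.const_mul ν)).add
    lim4).add lim5
  have heq := tendsto_nhds_unique hLHS (hRHS.congr fun n => (hid n).symm)
  linarith


end Energy

/-! ## Leray–Hopf packaging, core form -/

section Assembly

variable {T ν : ℝ} {f u : ℝ → EuclideanSpace ℝ (Fin 3) → EuclideanSpace ℝ (Fin 3)}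
  {p : ℝ → EuclideanSpace ℝ (Fin 3) → ℝ}

/-- The force integral of the localised balance over `(s, t)` is the interval integral
`∫ τ in s..t` of `IsLerayHopfOn` (`s ≤ t`). [folklore] -/
private theorem intervalIntegral_eq_integral_Ioo {g : ℝ → ℝ} {s t : ℝ} (hst : s ≤ t) :
    ∫ τ in s..t, g τ = ∫ τ in Ioo s t, g τ := by
  rw [intervalIntegral.integral_of_le hst, integral_Ioc_eq_integral_Ioo]

/-- **Finite energy classical solutions of FORCED Navier–Stokes are Leray–Hopf solutions — core
statement, a.e. normalisation.** Given Tao's forced pressure normalisation in its corrected a.e.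
form (Lemma 4.1 (i) WITH force, `hP = tao2011_forced_pressure_normalisation_ae`) and the
estimate of the pressure term `X₅` (`hX5`, a theorem of the tree), a classical solution of the
forced system on `[0, T] × ℝ³` with `sup_t ∫|u(t)|² ≤ A < ∞`, `∇u ∈ L²_{t,x}`, force slices
`∫|f(t)|² ≤ C_f < ∞` and force-potential slices `∫|Δ⁻¹∇·f(t)|² ≤ Π < ∞` is a Leray–Hopf weak solution
on `[0, T)` from `u(0)` WITH force `f` (energy *equality* with the work term `∫⟪f,u⟫` from every
time), and `u ∈ C([0,T]; L²)`. [cite: Tao2011, Lemma 8.1 + Lemma 4.1 (i), with (9)] -/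
theorem IsClassicalNSSolutionOn.isLerayHopfOn_of_finiteEnergy_forced_ae'
    (hP : tao2011_forced_pressure_normalisation_ae) (hX5 : tao2011_pressureTerm_estimate)
    (h : IsClassicalNSSolutionOn (Icc 0 T) ν f u p) (hν : 0 < ν) (hT : 0 < T)
    {Cf : ℝ≥0∞} (hCft : Cf ≠ ⊤) (hCf : ∀ t ∈ Icc 0 T, ∫⁻ x, ‖f t x‖ₑ ^ 2 ≤ Cf)
    {Pf : ℝ≥0∞} (hPft : Pf ≠ ⊤)
    (hπm : ∀ t ∈ Icc 0 T, AEStronglyMeasurable (forcePotential (f t)) volume)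
    (hπ : ∀ t ∈ Icc 0 T, ∫⁻ x, ‖forcePotential (f t) x‖ₑ ^ 2 ≤ Pf)
    {A : ℝ≥0∞} (hAt : A ≠ ⊤) (hA : ∀ t ∈ Icc 0 T, ∫⁻ x, ‖u t x‖ₑ ^ 2 ≤ A)
    (hgrad : ∫⁻ τ in Ioo 0 T, ∫⁻ x, ENNReal.ofReal (frobeniusNormSq (fderiv ℝ (u τ) x)) < ⊤) :
    IsLerayHopfOn T ν f (u 0) u ∧ ContinuousInLpOn (Icc 0 T) 2 u := by
  have h0I : (0 : ℝ) ∈ Icc 0 T := left_mem_Icc.2 hT.le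
  have hfilter : 𝓝[>] (0 : ℝ) ≤ 𝓝[Icc 0 T] 0 :=
    nhdsWithin_le_of_mem (mem_of_superset (Ioo_mem_nhdsGT hT) Ioo_subset_Icc_self)
  have hu₃ := h.lintegral_enorm_pow_three_lt_top_forced hAt hA hgrad
  have hmem : ∀ t ∈ Icc 0 T, MemLp (u t) 2 volume := fun t ht =>
    memLp_two_of_lintegral_lt_top (h.contDiff_velocity ht).continuous ((hA t ht).trans_lt hAt.lt_top)
  -- the forced energy equality on every `[s, t] ⊆ [0, T]`
  have hE : ∀ {s t : ℝ}, 0 ≤ s → s ≤ t → t ≤ T → VectorCalculus.kineticEnergy (u t) +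
      ν * (∫⁻ τ in Ioo s t, ∫⁻ x, ENNReal.ofReal (frobeniusNormSq (fderiv ℝ (u τ) x))).toReal =
      VectorCalculus.kineticEnergy (u s) + ∫ τ in Ioo s t, ∫ x, ⟪f τ x, u τ x⟫ :=
    fun hs hst ht => h.energyEq_of_finiteEnergy_forced_ae hP hX5 hν hT hCft hCf hPft hπm hπ hAt hA
      hgrad hu₃ hs hst ht
  -- the force work is `O(t - s)`
  set M : ℝ := (Cf ^ (1 / 2 : ℝ) * A ^ (1 / 2 : ℝ)).toReal with hMdef
  have hM0 : 0 ≤ M := ENNReal.toReal_nonneg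
  have hEabs : ∀ {s t : ℝ}, 0 ≤ s → s ≤ t → t ≤ T → |VectorCalculus.kineticEnergy (u t) +
      ν * (∫⁻ τ in Ioo s t, ∫⁻ x, ENNReal.ofReal (frobeniusNormSq (fderiv ℝ (u τ) x))).toReal -
      VectorCalculus.kineticEnergy (u s)| ≤ M * (t - s) := by
    intro s t hs hst ht
    rw [hE hs hst ht, add_sub_cancel_left]
    exact h.abs_integral_inner_force_le hT hCft hCf hAt hA hs hst ht
  -- continuity in `L²`
  have hKE : ∀ t₀ ∈ Icc 0 T, Tendsto (fun t => VectorCalculus.kineticEnergy (u t))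
      (𝓝[Icc 0 T] t₀) (𝓝 (VectorCalculus.kineticEnergy (u t₀))) :=
    fun t₀ ht₀ => tendsto_kineticEnergy_of_energyIneq_forced hM0 hgrad hEabs ht₀
  have hweak : ∀ {w : EuclideanSpace ℝ (Fin 3) → EuclideanSpace ℝ (Fin 3)} (_ : MemLp w 2 volume)
      (t₀ : ℝ) (_ : t₀ ∈ Icc 0 T),
      Tendsto (fun t => ∫ x, ⟪u t x, w x⟫) (𝓝[Icc 0 T] t₀) (𝓝 (∫ x, ⟪u t₀ x, w x⟫)) :=
    fun hw t₀ ht₀ => tendsto_integral_inner_of_continuousOn h.smooth_velocity.continuousOn hmem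
      ENNReal.toReal_nonneg (fun t ht => toReal_eLpNorm_two_le hAt (hA t ht)) hw ht₀
  have hcont : ContinuousInLpOn (Icc 0 T) 2 u := continuousInLpOn_of_energy_of_weak hmem hKE hweak
  refine ⟨⟨IsClassicalNSSolutionOn.isWeakNSSolutionOn_holds h Subset.rfl, ⟨A.toNNReal, ?_⟩, hmem,
    ⟨fun t => fderiv ℝ (u t), ?_, hgrad, fun t ht => ?_, ?_⟩, fun w hw => ⟨?_, ?_⟩, ?_⟩, hcont⟩
  · -- energy bound a.e. on `(0, T)`
    refine (ae_restrict_iff' measurableSet_Ioo).2 (Eventually.of_forall fun t ht => ?_)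
    rw [ENNReal.coe_toNNReal hAt]
    exact hA t (Ioo_subset_Icc_self ht)
  · -- the classical gradient is a weak gradient
    exact (ae_restrict_iff' measurableSet_Ioo).2 (Eventually.of_forall fun t ht =>
      hasWeakGradient_fderiv_of_contDiff
        (contDiff_infty.1 (h.contDiff_velocity (Ioo_subset_Icc_self ht)) 1))
  · -- energy (in)equality from `0`, WITH the work of the force
    rw [intervalIntegral_eq_integral_Ioo ht.1]
    exact (hE le_rfl ht.1 ht.2).le
  · -- energy (in)equality from every `s ∈ (0, T)`
    exact (ae_restrict_iff' measurableSet_Ioo).2 (Eventually.of_forall fun s hs t ht => by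
      rw [intervalIntegral_eq_integral_Ioo ht.1]
      exact (hE hs.1.le ht.1 ht.2).le)
  · -- weak continuity on `(0, T]`
    intro t ht
    exact (hweak hw t (Ioc_subset_Icc_self ht)).mono_left (nhdsWithin_mono _ Ioc_subset_Icc_self)
  · -- weak attainment of the datum
    exact (hweak hw 0 h0I).mono_left hfilter
  · -- strong attainment of the datum
    exact (hcont.2 0 h0I).mono_left hfilter

end Assembly

/-! ## Finite dissipation from the a.e. normalisation (Tao §8 with force); final packaging -/

section EnergyClass

variable {T ν : ℝ} {f u : ℝ → EuclideanSpace ℝ (Fin 3) → EuclideanSpace ℝ (Fin 3)}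
  {p : ℝ → EuclideanSpace ℝ (Fin 3) → ℝ}

/-- Forced bookkeeping of (65) integrated in time: the localised energy identity WITH force plus
the absorbed slice bounds give `E(t) + (ν/2)∫₀ᵗ X₁ ≤ E(0) + (e_a + e_b + e_c + e_f) t`. [folklore] -/
private theorem energy_assembly_arith_forced {Et E0 I₃ I₁ I₂ IP If ν t ea eb ec ef : ℝ}
    (hid : 2⁻¹ * Et - 2⁻¹ * E0 = 2⁻¹ * I₃ - ν * I₁ - ν * I₂ + IP + If) (hIf : If ≤ ef * t)
    (ha : 2⁻¹ * I₃ ≤ ν / 8 * I₁ + ea * t) (hb : -ν * I₂ ≤ ν / 8 * I₁ + eb * t)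
    (hc : IP ≤ ν / 4 * I₁ + ec * t) :
    2⁻¹ * Et + ν / 2 * I₁ ≤ 2⁻¹ * E0 + (ea + eb + ec + ef) * t := by
  have h1 : (ea + eb + ec + ef) * t = ea * t + eb * t + ec * t + ef * t := by ring
  rw [h1]
  linarith

/-- The error constants of the localised inequality at radius ratio `r ≥ 1/4` are dominated by
one constant (pure arithmetic: `1/r² ≤ 16`, `1/r⁴ ≤ 256`, `1/r ≤ 4`). [folklore] -/
private theorem errconst_le {C₁ C₅ K6 ν A r PA ef : ℝ} (hC₁ : 0 ≤ C₁) (hC₅ : 0 ≤ C₅)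
    (hK6 : 0 ≤ K6) (hν : 0 < ν) (hr4 : 1 / 4 ≤ r) (hPA : 0 ≤ PA) :
    2 * C₁ ^ 2 * (ν * A ^ 2 / r ^ 2) + 1048576 * C₁ ^ 4 * K6 * (A ^ 6 / (ν ^ 3 * r ^ 4)) +
      384 * C₁ ^ 2 * (ν * A ^ 2 / r ^ 2) +
      (C₅ / 4 * (ν * A ^ 2 / r ^ 2) + 64 * C₅ * (A ^ 6 / (ν ^ 3 * r ^ 4)) + 8 * (C₁ / r) * PA) + ef ≤
    (386 * C₁ ^ 2 + C₅ + 1048576 * C₁ ^ 4 * K6 + 64 * C₅) * (ν * A ^ 2 * 16 + A ^ 6 / ν ^ 3 * 256) +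
      32 * C₁ * PA + ef := by
  have hr : 0 < r := by linarith
  set Q₁ : ℝ := ν * A ^ 2 / r ^ 2 with hQ₁
  set Q₂ : ℝ := A ^ 6 / (ν ^ 3 * r ^ 4) with hQ₂
  set S : ℝ := 386 * C₁ ^ 2 + C₅ + 1048576 * C₁ ^ 4 * K6 + 64 * C₅ with hS
  have hK6' : 0 ≤ 1048576 * C₁ ^ 4 * K6 := by positivity
  have hS0 : 0 ≤ S := by positivity
  have hQ₁0 : 0 ≤ Q₁ := by positivity
  have hQ₂0 : 0 ≤ Q₂ := by positivity
  have h1r2 : 1 / r ^ 2 ≤ 16 := by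
    rw [div_le_iff₀ (by positivity)]
    nlinarith [pow_le_pow_left₀ (by norm_num : (0 : ℝ) ≤ 1 / 4) hr4 2]
  have h1r4 : 1 / r ^ 4 ≤ 256 := by
    rw [div_le_iff₀ (by positivity)]
    nlinarith [pow_le_pow_left₀ (by norm_num : (0 : ℝ) ≤ 1 / 4) hr4 4]
  have hP₁ : Q₁ ≤ ν * A ^ 2 * 16 := by
    calc Q₁ = ν * A ^ 2 * (1 / r ^ 2) := by rw [hQ₁]; ring
      _ ≤ ν * A ^ 2 * 16 := by gcongr
  have hP₂ : Q₂ ≤ A ^ 6 / ν ^ 3 * 256 := by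
    calc Q₂ = A ^ 6 / ν ^ 3 * (1 / r ^ 4) := by rw [hQ₂]; field_simp
      _ ≤ A ^ 6 / ν ^ 3 * 256 := by gcongr
  have hP₃ : 8 * (C₁ / r) * PA ≤ 32 * C₁ * PA := by
    have : C₁ / r ≤ 4 * C₁ := by
      rw [div_le_iff₀ hr]; nlinarith
    nlinarith
  have hc1 : 2 * C₁ ^ 2 * Q₁ + 384 * C₁ ^ 2 * Q₁ + C₅ / 4 * Q₁ ≤ S * (ν * A ^ 2 * 16) := by
    calc 2 * C₁ ^ 2 * Q₁ + 384 * C₁ ^ 2 * Q₁ + C₅ / 4 * Q₁ = (386 * C₁ ^ 2 + C₅ / 4) * Q₁ := by ring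
      _ ≤ S * (ν * A ^ 2 * 16) :=
          mul_le_mul (by rw [hS]; linarith) hP₁ hQ₁0 hS0
  have hc2 : 1048576 * C₁ ^ 4 * K6 * Q₂ + 64 * C₅ * Q₂ ≤ S * (A ^ 6 / ν ^ 3 * 256) := by
    calc 1048576 * C₁ ^ 4 * K6 * Q₂ + 64 * C₅ * Q₂
        = (1048576 * C₁ ^ 4 * K6 + 64 * C₅) * Q₂ := by ring
      _ ≤ S * (A ^ 6 / ν ^ 3 * 256) :=
          mul_le_mul (by rw [hS]; nlinarith [sq_nonneg C₁]) hP₂ hQ₂0 hS0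
  rw [mul_add]
  linarith

/-- **The localised energy inequality WITH force, uniform in the cut-off radius** (Tao 2011, §8,
(61)–(65) with the force terms `X₄` and the force-potential part of `X₅` kept; constants depending
on the a priori bound `A`). For a classical solution of the forced system on `[0,T] × ℝ³` with
`∫|u(t)|² ≤ A²`, `∫|f(t)|² ≤ C_f`, `∫|Δ⁻¹∇·f(t)|² ≤ Π`, and Tao's cut-offs `φ_n = θ⁸_{n+1,(n+1)/4}`,
there is `K ≥ 0` with `E_{φ_n}(u(t)) + (ν/2)∫₀ᵗ∫φ_n|∇u|² ≤ ½∫|u(0)|² + K T` for all `n` and all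
`t ∈ [0,T]`, GIVEN the forced pressure normalisation `hP` and the estimate of `X₅` `hX5`.
[cite: Tao2011, §8, proof of Lemma 8.1, (61)–(65)] -/
theorem IsClassicalNSSolutionOn.localisedEnergy_le_forced
    (hP : tao2011_forced_pressure_normalisation_ae) (hX5 : tao2011_pressureTerm_estimate)
    (h : IsClassicalNSSolutionOn (Icc 0 T) ν f u p) (hν : 0 < ν) (hT : 0 < T)
    {Cf : ℝ≥0∞} (hCft : Cf ≠ ⊤) (hCf : ∀ t ∈ Icc 0 T, ∫⁻ x, ‖f t x‖ₑ ^ 2 ≤ Cf)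
    {Pf : ℝ≥0∞} (hPft : Pf ≠ ⊤)
    (hπm : ∀ t ∈ Icc 0 T, AEStronglyMeasurable (forcePotential (f t)) volume)
    (hπ : ∀ t ∈ Icc 0 T, ∫⁻ x, ‖forcePotential (f t) x‖ₑ ^ 2 ≤ Pf)
    {A : ℝ} (hA0 : 0 ≤ A) (hEA : ∀ t ∈ Icc 0 T, ∫⁻ x, ‖u t x‖ₑ ^ 2 ≤ ENNReal.ofReal (A ^ 2)) :
    ∃ K : ℝ, 0 ≤ K ∧ ∀ (n : ℕ), ∀ t ∈ Icc 0 T,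
      localisedEnergy (fun x => taoCutoff ((n : ℝ) + 1) (((n : ℝ) + 1) / 4) x ^ 8) (u t) +
          ν / 2 * ∫ s in Ioo 0 t,
            localisedDissipation (fun x => taoCutoff ((n : ℝ) + 1) (((n : ℝ) + 1) / 4) x ^ 8) (u s) ≤
        2⁻¹ * (∫ x, ‖u 0 x‖ ^ 2) + K * T := by
  obtain ⟨C₅, hC₅0, hC₅⟩ := hX5
  obtain ⟨C₁, hC₁0, hC₁⟩ := exists_norm_fderiv_taoCutoff_le (E := EuclideanSpace ℝ (Fin 3))
  have hK0 : 0 ≤ gnsConst3 := gnsConst3_nonneg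
  have hU : UniqueDiffOn ℝ (Icc 0 T) := uniqueDiffOn_Icc hT
  have hfs : IsSmoothSpaceTimeOn (Icc 0 T) f := h.isSmoothSpaceTimeOn_force hU
  -- the two new constants: the force work and the force-potential pairing
  set CA : ℝ≥0∞ := Cf ^ (1 / 2 : ℝ) * (ENNReal.ofReal (A ^ 2)) ^ (1 / 2 : ℝ) with hCA
  have hCAt : CA ≠ ⊤ := ENNReal.mul_ne_top (ENNReal.rpow_ne_top_of_nonneg (by norm_num) hCft)
    (ENNReal.rpow_ne_top_of_nonneg (by norm_num) ENNReal.ofReal_ne_top)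
  set PA : ℝ≥0∞ := Pf ^ (1 / 2 : ℝ) * (ENNReal.ofReal (A ^ 2)) ^ (1 / 2 : ℝ) with hPA
  have hPAt : PA ≠ ⊤ := ENNReal.mul_ne_top (ENNReal.rpow_ne_top_of_nonneg (by norm_num) hPft)
    (ENNReal.rpow_ne_top_of_nonneg (by norm_num) ENNReal.ofReal_ne_top)
  set ef : ℝ := CA.toReal with hef
  have hef0 : 0 ≤ ef := ENNReal.toReal_nonneg
  -- the uniform constant (`r = (n+1)/4 ≥ 1/4`: `1/r² ≤ 16`, `1/r⁴ ≤ 256`, `1/r ≤ 4`)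
  set K : ℝ := (386 * C₁ ^ 2 + C₅ + 1048576 * C₁ ^ 4 * gnsConst3 ^ 6 + 64 * C₅) *
      (ν * A ^ 2 * 16 + A ^ 6 / ν ^ 3 * 256) + 32 * C₁ * PA.toReal + ef with hKdef
  have hKnn : 0 ≤ K := by positivity
  refine ⟨K, hKnn, fun n t ht => ?_⟩
  -- the radii
  set R : ℝ := (n : ℝ) + 1 with hRdef
  set r : ℝ := ((n : ℝ) + 1) / 4 with hrdef
  have hR : 0 < R := by positivity
  have hr : 0 < r := by positivity
  have hrR : 2 * r < R := by rw [hrdef, hRdef]; linarith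
  have hr4 : 1 / 4 ≤ r := by
    rw [hrdef]; have : (0 : ℝ) ≤ n := Nat.cast_nonneg n; linarith
  have hφ1 : ContDiff ℝ 1 fun x : EuclideanSpace ℝ (Fin 3) => taoCutoff R r x ^ 8 :=
    contDiff_taoCutoff_pow R r 8
  have hφc : HasCompactSupport fun x : EuclideanSpace ℝ (Fin 3) => taoCutoff R r x ^ 8 :=
    hasCompactSupport_taoCutoff_pow hR.le hr.le (by norm_num)
  have hCθ : ∀ x : EuclideanSpace ℝ (Fin 3), ‖fderiv ℝ (taoCutoff R r) x‖ ≤ C₁ / r := hC₁ R r hr hR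
  have hDφ : ∀ x v : EuclideanSpace ℝ (Fin 3),
      |fderiv ℝ (fun y => taoCutoff R r y ^ 8) x v| ≤ 8 * (C₁ / r) * ‖v‖ := by
    intro x v
    refine (abs_fderiv_taoCutoff_pow_eight_apply_le hCθ x v).trans ?_
    have hθ : taoCutoff R r x ^ 7 ≤ 1 := taoCutoff_pow_le_one _ _ x 7
    have hθ0 : 0 ≤ taoCutoff R r x ^ 7 := taoCutoff_pow_nonneg _ _ x 7
    have hc0 : 0 ≤ C₁ / r := by positivity
    nlinarith [norm_nonneg v, mul_nonneg hc0 (norm_nonneg v)]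
  -- slices
  have hI : ∀ {τ}, τ ∈ Ioo 0 t → τ ∈ Icc 0 T := fun hτ => ⟨hτ.1.le, hτ.2.le.trans ht.2⟩
  have hv1 : ∀ τ ∈ Icc 0 T, ContDiff ℝ 1 (u τ) := fun τ hτ =>
    (h.contDiff_velocity hτ).of_le (by exact_mod_cast le_top)
  have hint : ∀ τ ∈ Icc 0 T, Integrable fun x => ‖u τ x‖ ^ 2 := fun τ hτ =>
    integrable_sq_of_lintegral_enorm_sq_lt_top (h.contDiff_velocity hτ).continuous
      ((hEA τ hτ).trans_lt ENNReal.ofReal_lt_top)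
  have hA2 : ∀ τ ∈ Icc 0 T, ∫ x, ‖u τ x‖ ^ 2 ≤ A ^ 2 := by
    intro τ hτ
    have h' := hEA τ hτ
    rw [← ofReal_integral_norm_sq_eq_lintegral (hint τ hτ)] at h'
    exact (ENNReal.ofReal_le_ofReal_iff (by positivity)).1 h'
  -- the localised dissipation in time
  have hX0 : ∀ τ ∈ Ioo 0 t, 0 ≤ localisedDissipation
      (fun x : EuclideanSpace ℝ (Fin 3) => taoCutoff R r x ^ 8) (u τ) :=
    fun τ _ => localisedDissipation_nonneg (fun x => taoCutoff_pow_nonneg R r x 8) _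
  have hXi : IntegrableOn (fun τ => localisedDissipation
      (fun x : EuclideanSpace ℝ (Fin 3) => taoCutoff R r x ^ 8) (u τ)) (Ioo 0 t) :=
    ((continuousOn_localisedDissipation h.smooth_velocity hT
      ((continuous_taoCutoff R r).fun_pow 8) (isCompact_closedBall 0 R)
      (support_taoCutoff_pow_subset hR.le hr.le (by norm_num))).integrableOn_Icc).mono_set
      (Ioo_subset_Icc_self.trans (Icc_subset_Icc_right ht.2))
  -- the localised energy balance WITH force, (61) integrated over `(0, t)`
  have hid := h.energy_balance_cutoff hT hφ1 hφc le_rfl ht.1 ht.2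
  -- (a) transport
  have hIa : 2⁻¹ * (∫ τ in Ioo 0 t, ∫ x,
      fderiv ℝ (fun x : EuclideanSpace ℝ (Fin 3) => taoCutoff R r x ^ 8) x (u τ x) * ‖u τ x‖ ^ 2) ≤
      ν / 8 * (∫ τ in Ioo 0 t, localisedDissipation
        (fun x : EuclideanSpace ℝ (Fin 3) => taoCutoff R r x ^ 8) (u τ)) +
        (2 * C₁ ^ 2 * (ν * A ^ 2 / r ^ 2) +
          1048576 * C₁ ^ 4 * gnsConst3 ^ 6 * (A ^ 6 / (ν ^ 3 * r ^ 4))) * t :=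
    mul_integral_Ioo_le_of_slice_le ht.1 hXi hX0 (by positivity) (by positivity) fun τ hτ =>
      half_transport_le (hv1 τ (hI hτ)) (hint τ (hI hτ)) (hA2 τ (hI hτ)) hA0 hr hR hCθ hC₁0.le hν
  -- (b) viscous cross term
  have hIb : -ν * (∫ τ in Ioo 0 t, ∫ x, ∑ i,
      fderiv ℝ (fun x : EuclideanSpace ℝ (Fin 3) => taoCutoff R r x ^ 8) x
        (stdOrthonormalBasis ℝ (EuclideanSpace ℝ (Fin 3)) i) *
        ⟪fderiv ℝ (u τ) x (stdOrthonormalBasis ℝ (EuclideanSpace ℝ (Fin 3)) i), u τ x⟫) ≤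
      ν / 8 * (∫ τ in Ioo 0 t, localisedDissipation
        (fun x : EuclideanSpace ℝ (Fin 3) => taoCutoff R r x ^ 8) (u τ)) +
        (384 * C₁ ^ 2 * (ν * A ^ 2 / r ^ 2)) * t :=
    mul_integral_Ioo_le_of_slice_le ht.1 hXi hX0 (by positivity) (by positivity) fun τ hτ =>
      neg_viscous_cross_le (hv1 τ (hI hτ)) (hint τ (hI hτ)) (hA2 τ (hI hτ)) hr hR hCθ hC₁0.le hν
  -- (c) pressure, for a.e. `τ` by the FORCED Lemma 4.1 (i): `p = p̃[u] + Δ⁻¹∇·f + C(τ)`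
  have hE' : ∃ C : ℝ≥0, ∀ τ ∈ Icc 0 T, ∫⁻ x, ‖u τ x‖ₑ ^ 2 ≤ C :=
    ⟨(ENNReal.ofReal (A ^ 2)).toNNReal, fun τ hτ =>
      (hEA τ hτ).trans (ENNReal.coe_toNNReal ENNReal.ofReal_ne_top).ge⟩
  obtain ⟨Cp, -, hae⟩ := hP hν hT h hfs (lintegral_sqrt_force_lt_top hCft hCf) hE'
  have hIc : (∫ τ in Ioo 0 t, ∫ x, p τ x *
      fderiv ℝ (fun x : EuclideanSpace ℝ (Fin 3) => taoCutoff R r x ^ 8) x (u τ x)) ≤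
      ν / 4 * (∫ τ in Ioo 0 t, localisedDissipation
        (fun x : EuclideanSpace ℝ (Fin 3) => taoCutoff R r x ^ 8) (u τ)) +
        (C₅ / 4 * (ν * A ^ 2 / r ^ 2) + 64 * C₅ * (A ^ 6 / (ν ^ 3 * r ^ 4)) +
          8 * (C₁ / r) * PA.toReal) * t := by
    refine integral_Ioo_le_of_slice_le_ae ht.1 hXi hX0 (by positivity)
      (add_nonneg (by positivity) (by positivity)) ?_
    have hae' := ae_restrict_of_ae_restrict_of_subset
      (Ioo_subset_Icc_self.trans (Icc_subset_Icc_right ht.2)) hae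
    filter_upwards [hae', ae_restrict_mem measurableSet_Ioo] with τ hτp hτ
    have hτI := hI hτ
    have hv := h.contDiff_velocity hτI
    -- the force-potential pairing
    have hD : Continuous fun x =>
        fderiv ℝ (fun y : EuclideanSpace ℝ (Fin 3) => taoCutoff R r y ^ 8) x (u τ x) :=
      (hφ1.continuous_fderiv one_ne_zero).clm_apply hv.continuous
    have hπle := lintegral_enorm_potential_mul_le (hπm τ hτI) hv.continuous (hπ τ hτI) (hEA τ hτI)
      (by positivity : (0 : ℝ) ≤ 8 * (C₁ / r)) (fun x => hDφ x (u τ x))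
    have hπi : Integrable fun x => forcePotential (f τ) x *
        fderiv ℝ (fun y : EuclideanSpace ℝ (Fin 3) => taoCutoff R r y ^ 8) x (u τ x) :=
      ⟨(hπm τ hτI).mul hD.aestronglyMeasurable,
        hπle.trans_lt (ENNReal.mul_lt_top ENNReal.ofReal_lt_top hPAt.lt_top)⟩
    have hπabs : |∫ x, forcePotential (f τ) x *
        fderiv ℝ (fun y : EuclideanSpace ℝ (Fin 3) => taoCutoff R r y ^ 8) x (u τ x)| ≤
        8 * (C₁ / r) * PA.toReal := by
      have h1 := norm_integral_le_lintegral_norm (μ := volume) fun x => forcePotential (f τ) x *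
        fderiv ℝ (fun y : EuclideanSpace ℝ (Fin 3) => taoCutoff R r y ^ 8) x (u τ x)
      rw [Real.norm_eq_abs] at h1
      refine h1.trans ?_
      have h2 : ∫⁻ x, ENNReal.ofReal ‖forcePotential (f τ) x *
          fderiv ℝ (fun y : EuclideanSpace ℝ (Fin 3) => taoCutoff R r y ^ 8) x (u τ x)‖ ≤
          ENNReal.ofReal (8 * (C₁ / r)) * PA := by
        refine le_trans (lintegral_mono fun x => ?_) hπle
        rw [ofReal_norm]
      refine (ENNReal.toReal_mono (ENNReal.mul_ne_top ENNReal.ofReal_ne_top hPAt) h2).trans_eq ?_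
      rw [ENNReal.toReal_mul, ENNReal.toReal_ofReal (by positivity)]
    -- the `p̃` part by `X₅` with `ε = ν/4`
    have heq := integral_forcedPressure_shift_eq (hv1 τ hτI) (h.divFree τ hτI) hφ1 hφc
      (h.contDiff_pressure hτI).continuous hπi hτp
    have h5 := hC₅ (u τ) hv A hA0 (hEA τ hτI) R r hr hrR (ν / 4) (by positivity)
    have hX1 := localisedDissipation_nonneg (fun x => taoCutoff_pow_nonneg R r x 8) (u τ)
    rw [heq]
    have e1 : C₅ * (ν / 4 * A ^ 2 / r ^ 2 + A ^ 6 / ((ν / 4) ^ 3 * r ^ 4)) =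
        C₅ / 4 * (ν * A ^ 2 / r ^ 2) + 64 * C₅ * (A ^ 6 / (ν ^ 3 * r ^ 4)) := by
      field_simp
      ring
    have h5' := (le_abs_self _).trans h5
    rw [e1] at h5'
    have hπ' := (le_abs_self _).trans hπabs
    linarith
  -- (f) the work of the force
  have hIf : (∫ τ in Ioo 0 t, ∫ x, taoCutoff R r x ^ 8 * ⟪f τ x, u τ x⟫) ≤ ef * t := by
    have h0 := integral_Ioo_le_of_slice_le_ae (F := fun τ => ∫ x, taoCutoff R r x ^ 8 * ⟪f τ x, u τ x⟫)
      (κ := 0) ht.1 hXi hX0 le_rfl hef0 ?_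
    · simpa using h0
    filter_upwards [ae_restrict_mem measurableSet_Ioo] with τ hτ
    have hτI := hI hτ
    rw [zero_mul, zero_add]
    have hfc : Continuous (f τ) := h.continuous_force_slice hU hτI
    have huc : Continuous (u τ) := (h.contDiff_velocity hτI).continuous
    have hle : ∫⁻ x, ENNReal.ofReal ‖taoCutoff R r x ^ 8 * ⟪f τ x, u τ x⟫‖ ≤ CA := by
      refine le_trans (lintegral_mono fun x => ?_)
        (lintegral_enorm_force_mul_enorm_le hfc huc (hCf τ hτI) (hEA τ hτI))
      rw [← ofReal_norm, ← ofReal_norm, ← ENNReal.ofReal_mul (norm_nonneg _), Real.norm_eq_abs,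
        abs_mul]
      refine ENNReal.ofReal_le_ofReal ?_
      calc |taoCutoff R r x ^ 8| * |⟪f τ x, u τ x⟫| ≤ 1 * (‖f τ x‖ * ‖u τ x‖) := by
            gcongr
            · rw [abs_of_nonneg (taoCutoff_pow_nonneg R r x 8)]
              exact taoCutoff_pow_le_one R r x 8
            · exact abs_real_inner_le_norm _ _
        _ = ‖f τ x‖ * ‖u τ x‖ := one_mul _
    have h1 := norm_integral_le_lintegral_norm (μ := volume) fun x =>
      taoCutoff R r x ^ 8 * ⟪f τ x, u τ x⟫
    rw [Real.norm_eq_abs] at h1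
    exact (le_abs_self _).trans (h1.trans (ENNReal.toReal_mono hCAt hle))
  -- the error constants are dominated by `K` (using `r ≥ 1/4`)
  have hle := errconst_le (A := A) (ef := ef) hC₁0.le hC₅0
    (by positivity : (0 : ℝ) ≤ gnsConst3 ^ 6) hν hr4 (ENNReal.toReal_nonneg (a := PA))
  have hsum : (2 * C₁ ^ 2 * (ν * A ^ 2 / r ^ 2) +
        1048576 * C₁ ^ 4 * gnsConst3 ^ 6 * (A ^ 6 / (ν ^ 3 * r ^ 4)) +
      384 * C₁ ^ 2 * (ν * A ^ 2 / r ^ 2) +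
      (C₅ / 4 * (ν * A ^ 2 / r ^ 2) + 64 * C₅ * (A ^ 6 / (ν ^ 3 * r ^ 4)) +
        8 * (C₁ / r) * PA.toReal) + ef) * t ≤ K * T :=
    calc _ ≤ K * t := mul_le_mul_of_nonneg_right (by rw [hKdef]; exact hle) ht.1
      _ ≤ K * T := mul_le_mul_of_nonneg_left ht.2 hKnn
  -- the initial localised energy
  have hE0 : 2⁻¹ * (∫ x, taoCutoff R r x ^ 8 * ‖u 0 x‖ ^ 2) ≤ 2⁻¹ * ∫ x, ‖u 0 x‖ ^ 2 :=
    localisedEnergy_le_of_le_one (fun x => taoCutoff_pow_nonneg R r x 8)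
      (fun x => taoCutoff_pow_le_one R r x 8) (hint 0 ⟨le_rfl, hT.le⟩)
  have key : 2⁻¹ * (∫ x, taoCutoff R r x ^ 8 * ‖u t x‖ ^ 2) +
      ν / 2 * (∫ τ in Ioo 0 t, localisedDissipation
        (fun x : EuclideanSpace ℝ (Fin 3) => taoCutoff R r x ^ 8) (u τ)) ≤
      2⁻¹ * (∫ x, taoCutoff R r x ^ 8 * ‖u 0 x‖ ^ 2) +
        ((2 * C₁ ^ 2 * (ν * A ^ 2 / r ^ 2) +
            1048576 * C₁ ^ 4 * gnsConst3 ^ 6 * (A ^ 6 / (ν ^ 3 * r ^ 4))) +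
          384 * C₁ ^ 2 * (ν * A ^ 2 / r ^ 2) +
          (C₅ / 4 * (ν * A ^ 2 / r ^ 2) + 64 * C₅ * (A ^ 6 / (ν ^ 3 * r ^ 4)) +
            8 * (C₁ / r) * PA.toReal) + ef) * t :=
    energy_assembly_arith_forced hid hIf hIa hIb hIc
  calc localisedEnergy (fun x => taoCutoff R r x ^ 8) (u t) +
        ν / 2 * ∫ s in Ioo 0 t, localisedDissipation (fun x => taoCutoff R r x ^ 8) (u s)
      = 2⁻¹ * (∫ x, taoCutoff R r x ^ 8 * ‖u t x‖ ^ 2) +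
          ν / 2 * (∫ τ in Ioo 0 t, localisedDissipation
            (fun x : EuclideanSpace ℝ (Fin 3) => taoCutoff R r x ^ 8) (u τ)) := rfl
    _ ≤ 2⁻¹ * (∫ x, ‖u 0 x‖ ^ 2) + K * T := by linarith [key, hE0, hsum]

/-- **Finite dissipation for finite energy classical solutions of FORCED Navier–Stokes, from the
forced pressure normalisation alone** (Tao 2011, end of the proof of Lemma 8.1: "inserting this back
into (65) and integrating … monotone convergence"; forced terms kept, constants depending on the a
priori bound `A`). GIVEN `hP = tao2011_forced_pressure_normalisation_ae` (and the tree's theorem `hX5`),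
a classical solution of the forced system on `[0, T] × ℝ³` with `sup_t ∫|u(t)|² ≤ A < ∞`, force slices
`∫|f(t)|² ≤ C_f < ∞` and force-potential slices `∫|Δ⁻¹∇·f(t)|² ≤ Π < ∞` has `∫₀ᵀ∫|∇u|² < ∞`.
[cite: Tao2011, Lemma 8.1 (arXiv Lemma 44), proof §8 (61)–(65)] -/
theorem IsClassicalNSSolutionOn.lintegral_gradient_lt_top_forced
    (hP : tao2011_forced_pressure_normalisation_ae) (hX5 : tao2011_pressureTerm_estimate)
    (h : IsClassicalNSSolutionOn (Icc 0 T) ν f u p) (hν : 0 < ν) (hT : 0 < T)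
    {Cf : ℝ≥0∞} (hCft : Cf ≠ ⊤) (hCf : ∀ t ∈ Icc 0 T, ∫⁻ x, ‖f t x‖ₑ ^ 2 ≤ Cf)
    {Pf : ℝ≥0∞} (hPft : Pf ≠ ⊤)
    (hπm : ∀ t ∈ Icc 0 T, AEStronglyMeasurable (forcePotential (f t)) volume)
    (hπ : ∀ t ∈ Icc 0 T, ∫⁻ x, ‖forcePotential (f t) x‖ₑ ^ 2 ≤ Pf)
    {A : ℝ≥0∞} (hAt : A ≠ ⊤) (hA : ∀ t ∈ Icc 0 T, ∫⁻ x, ‖u t x‖ₑ ^ 2 ≤ A) :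
    ∫⁻ τ in Ioo 0 T, ∫⁻ x, ENNReal.ofReal (frobeniusNormSq (fderiv ℝ (u τ) x)) < ⊤ := by
  -- a real energy bound
  set Ar : ℝ := Real.sqrt A.toReal with hArdef
  have hAr0 : 0 ≤ Ar := Real.sqrt_nonneg _
  have hAr2 : ENNReal.ofReal (Ar ^ 2) = A := by
    rw [hArdef, Real.sq_sqrt ENNReal.toReal_nonneg, ENNReal.ofReal_toReal hAt]
  have hEA : ∀ t ∈ Icc 0 T, ∫⁻ x, ‖u t x‖ₑ ^ 2 ≤ ENNReal.ofReal (Ar ^ 2) := fun t ht =>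
    hAr2 ▸ hA t ht
  obtain ⟨K, hK0, hK⟩ := h.localisedEnergy_le_forced hP hX5 hν hT hCft hCf hPft hπm hπ hAr0 hEA
  -- slices
  have hC1 : ∀ t ∈ Icc 0 T, ContDiff ℝ 1 (u t) := fun t ht =>
    (h.contDiff_velocity ht).of_le (by exact_mod_cast le_top)
  have hint : ∀ t ∈ Icc 0 T, Integrable fun x => ‖u t x‖ ^ 2 := fun t ht =>
    integrable_sq_of_lintegral_enorm_sq_lt_top (h.contDiff_velocity ht).continuous
      ((hEA t ht).trans_lt ENNReal.ofReal_lt_top)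
  have hTT : T ∈ Icc 0 T := ⟨hT.le, le_rfl⟩
  -- the cutoff sequence
  have hpos : ∀ n : ℕ, (0 : ℝ) < (n : ℝ) + 1 := fun n => by positivity
  set φ : ℕ → EuclideanSpace ℝ (Fin 3) → ℝ := fun n x =>
    taoCutoff ((n : ℝ) + 1) (((n : ℝ) + 1) / 4) x ^ 8 with hφdef
  have hφ0 : ∀ n x, 0 ≤ φ n x := fun n x => taoCutoff_pow_nonneg _ _ _ _
  have hφ1 : ∀ n x, φ n x ≤ 1 := fun n x => taoCutoff_pow_le_one _ _ _ _
  have hφc : ∀ n, Continuous (φ n) := fun n => (continuous_taoCutoff _ _).pow 8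
  have hφK : ∀ n, Function.support (φ n) ⊆ closedBall (0 : EuclideanSpace ℝ (Fin 3)) ((n : ℝ) + 1) :=
    fun n => support_taoCutoff_pow_subset (hpos n).le (by positivity) (by norm_num)
  have hφcs : ∀ n, HasCompactSupport (φ n) := fun n =>
    hasCompactSupport_taoCutoff_pow (hpos n).le (by positivity) (by norm_num)
  have hφmono : ∀ x, Monotone fun n => φ n x := by
    intro x m n hmn
    simp only [hφdef]
    apply pow_le_pow_left₀ (taoCutoff_nonneg _ _ _)
    exact taoCutoff_quarter_mono x (hpos m) (by exact_mod_cast Nat.add_le_add_right hmn 1)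
  have hφev : ∀ x, ∀ᶠ n : ℕ in atTop, φ n x = 1 := by
    intro x
    have hev : ∀ᶠ n : ℕ in atTop, 2 * ‖x‖ ≤ (n : ℝ) :=
      tendsto_natCast_atTop_atTop.eventually_ge_atTop (2 * ‖x‖)
    filter_upwards [hev] with n hn
    simp only [hφdef]
    rw [taoCutoff_quarter_eq_one x (hpos n) (by linarith), one_pow]
  -- the uniform real bound for each `n`
  set B : ℝ := (∫ x, ‖u 0 x‖ ^ 2) + 2 * (K * T) with hBdef
  have hreal : ∀ n, ν * ∫ s in Ioo 0 T, localisedDissipation (φ n) (u s) ≤ B := by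
    intro n
    have h1 := hK n T hTT
    have h2 : 0 ≤ localisedEnergy (φ n) (u T) := localisedEnergy_nonneg (hφ0 n) _
    simp only [hφdef] at h1 h2 ⊢
    nlinarith
  -- continuity and integrability of the localised dissipation in time
  have hLDc : ∀ n, ContinuousOn (fun t => localisedDissipation (φ n) (u t)) (Icc 0 T) := fun n =>
    continuousOn_localisedDissipation h.smooth_velocity hT (hφc n) (isCompact_closedBall 0 _) (hφK n)
  have hLDi : ∀ n, IntegrableOn (fun t => localisedDissipation (φ n) (u t)) (Ioo 0 T) := fun n =>
    ((hLDc n).integrableOn_Icc).mono_set Ioo_subset_Icc_self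
  -- the inner lintegrals on `(0, T)`
  have hinner : ∀ n, ∀ t ∈ Ioo 0 T,
      ∫⁻ x, ENNReal.ofReal (φ n x * frobeniusNormSq (fderiv ℝ (u t) x)) =
        ENNReal.ofReal (localisedDissipation (φ n) (u t)) := by
    intro n t ht
    have ht' : t ∈ Icc 0 T := Ioo_subset_Icc_self ht
    have hci : Continuous fun x => φ n x * frobeniusNormSq (fderiv ℝ (u t) x) :=
      (hφc n).mul (continuous_frobeniusNormSq_clm.comp ((hC1 t ht').continuous_fderiv one_ne_zero))
    have hii : Integrable fun x => φ n x * frobeniusNormSq (fderiv ℝ (u t) x) :=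
      hci.integrable_of_hasCompactSupport (hφcs n).mul_right
    rw [localisedDissipation, ofReal_integral_eq_lintegral_ofReal hii
      (ae_of_all _ fun x => mul_nonneg (hφ0 n x) (frobeniusNormSq_nonneg _))]
  have ha : ∀ n, ∫⁻ t in Ioo 0 T, ∫⁻ x,
      ENNReal.ofReal (φ n x * frobeniusNormSq (fderiv ℝ (u t) x)) =
        ENNReal.ofReal (∫ t in Ioo 0 T, localisedDissipation (φ n) (u t)) := by
    intro n
    rw [ofReal_integral_eq_lintegral_ofReal (hLDi n)
      (ae_of_all _ fun t => localisedDissipation_nonneg (hφ0 n) (u t))]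
    refine setLIntegral_congr_fun measurableSet_Ioo ?_
    exact fun t ht => hinner n t ht
  have hameas : ∀ n, AEMeasurable (fun t => ∫⁻ x,
      ENNReal.ofReal (φ n x * frobeniusNormSq (fderiv ℝ (u t) x))) (volume.restrict (Ioo 0 T)) := by
    intro n
    have h1 : AEMeasurable (fun t => ENNReal.ofReal (localisedDissipation (φ n) (u t)))
        (volume.restrict (Ioo 0 T)) :=
      ENNReal.measurable_ofReal.comp_aemeasurable
        (((hLDc n).mono Ioo_subset_Icc_self).aemeasurable measurableSet_Ioo)
    refine h1.congr ?_
    filter_upwards [ae_restrict_mem measurableSet_Ioo] with t ht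
    exact (hinner n t ht).symm
  -- monotone convergence in `x`, then in `t`
  have hsupx : ∀ t ∈ Ioo 0 T, ∫⁻ x, ENNReal.ofReal (frobeniusNormSq (fderiv ℝ (u t) x)) =
      ⨆ n, ∫⁻ x, ENNReal.ofReal (φ n x * frobeniusNormSq (fderiv ℝ (u t) x)) := by
    intro t ht
    have ht' : t ∈ Icc 0 T := Ioo_subset_Icc_self ht
    rw [← lintegral_iSup']
    · refine lintegral_congr fun x => ?_
      apply le_antisymm
      · obtain ⟨N, hN⟩ := (hφev x).exists
        refine le_iSup_of_le N ?_
        rw [hN, one_mul]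
      · exact iSup_le fun n => ENNReal.ofReal_le_ofReal
          (mul_le_of_le_one_left (frobeniusNormSq_nonneg _) (hφ1 n x))
    · intro n
      exact ((hφc n).mul (continuous_frobeniusNormSq_clm.comp
        ((hC1 t ht').continuous_fderiv one_ne_zero))).measurable.ennreal_ofReal.aemeasurable
    · exact ae_of_all _ fun x m n hmn => ENNReal.ofReal_le_ofReal
        (mul_le_mul_of_nonneg_right (hφmono x hmn) (frobeniusNormSq_nonneg _))
  have hsup : ∫⁻ t in Ioo 0 T, ∫⁻ x, ENNReal.ofReal (frobeniusNormSq (fderiv ℝ (u t) x)) =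
      ⨆ n, ∫⁻ t in Ioo 0 T, ∫⁻ x, ENNReal.ofReal (φ n x * frobeniusNormSq (fderiv ℝ (u t) x)) := by
    rw [← lintegral_iSup' hameas]
    · exact setLIntegral_congr_fun measurableSet_Ioo hsupx
    · exact ae_of_all _ fun t m n hmn => lintegral_mono fun x => ENNReal.ofReal_le_ofReal
        (mul_le_mul_of_nonneg_right (hφmono x hmn) (frobeniusNormSq_nonneg _))
  -- conclusion: every term of the supremum is `≤ B/ν`
  have hν' : ENNReal.ofReal ν ≠ 0 := (ENNReal.ofReal_pos.2 hν).ne'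
  have hbound : ∀ n, ∫⁻ t in Ioo 0 T, ∫⁻ x,
      ENNReal.ofReal (φ n x * frobeniusNormSq (fderiv ℝ (u t) x)) ≤
        ENNReal.ofReal B / ENNReal.ofReal ν := by
    intro n
    rw [ENNReal.le_div_iff_mul_le (Or.inl hν') (Or.inl ENNReal.ofReal_ne_top), mul_comm, ha n,
      ← ENNReal.ofReal_mul hν.le]
    exact ENNReal.ofReal_le_ofReal (hreal n)
  rw [hsup]
  exact (iSup_le hbound).trans_lt (ENNReal.div_lt_top ENNReal.ofReal_ne_top hν')

/-- **Finite energy classical solutions of FORCED Navier–Stokes are Leray–Hopf — conditional on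
the forced pressure normalisation ONLY.** The packaging
`IsClassicalNSSolutionOn.isLerayHopfOn_of_finiteEnergy_forced` of `TaoForcedFiniteEnergyLerayHopf`
with the forced Lemma 8.1 hypothesis `hL` REMOVED (its one use, finiteness of the dissipation, is
`lintegral_gradient_lt_top_forced`): GIVEN `hP = tao2011_forced_pressure_normalisation_ae`, a classical
solution of the forced system on `[0, T] × ℝ³` with `sup_t ∫|u(t)|² < ∞`, force slices uniformly in `L²`
and force-potential slices uniformly in `L²` is a Leray–Hopf weak solution on `[0,T)` from `u(0)` with
force `f` (energy equality with the work term), and `u ∈ C([0,T]; L²)`.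
[cite: Tao2011, Lemma 8.1 + Lemma 4.1 (i), with (9)] -/
theorem IsClassicalNSSolutionOn.isLerayHopfOn_of_finiteEnergy_forced_ae
    (hP : tao2011_forced_pressure_normalisation_ae)
    (h : IsClassicalNSSolutionOn (Icc 0 T) ν f u p) (hν : 0 < ν) (hT : 0 < T)
    {Cf : ℝ≥0∞} (hCft : Cf ≠ ⊤) (hCf : ∀ t ∈ Icc 0 T, ∫⁻ x, ‖f t x‖ₑ ^ 2 ≤ Cf)
    {Pf : ℝ≥0∞} (hPft : Pf ≠ ⊤)
    (hπm : ∀ t ∈ Icc 0 T, AEStronglyMeasurable (forcePotential (f t)) volume)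
    (hπ : ∀ t ∈ Icc 0 T, ∫⁻ x, ‖forcePotential (f t) x‖ₑ ^ 2 ≤ Pf)
    (hfe : ∃ A : ℝ≥0∞, A < ⊤ ∧ ∀ t ∈ Icc 0 T, ∫⁻ x, ‖u t x‖ₑ ^ 2 ≤ A) :
    IsLerayHopfOn T ν f (u 0) u ∧ ContinuousInLpOn (Icc 0 T) 2 u := by
  obtain ⟨A, hAt, hA⟩ := hfe
  have hgrad := h.lintegral_gradient_lt_top_forced hP tao2011_pressureTerm_estimate_holds hν hT hCft
    hCf hPft hπm hπ hAt.ne hA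
  exact h.isLerayHopfOn_of_finiteEnergy_forced_ae' hP tao2011_pressureTerm_estimate_holds hν hT hCft hCf
    hPft hπm hπ hAt.ne hA hgrad

/-- **The forced energy equality, conditional on the forced pressure normalisation only**: under
the same hypotheses, `∇u ∈ L²_{t,x}` and `½‖u(t)‖₂² + ν∫ₛᵗ∫|∇u|² = ½‖u(s)‖₂² + ∫ₛᵗ∫⟪f,u⟫` for all
`0 ≤ s ≤ t ≤ T`. [cite: Tao2011, Lemma 8.1 + Lemma 4.1 (i), with (9)] -/
theorem IsClassicalNSSolutionOn.energyEq_of_finiteEnergy_forced_ae_of_fact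
    (hP : tao2011_forced_pressure_normalisation_ae)
    (h : IsClassicalNSSolutionOn (Icc 0 T) ν f u p) (hν : 0 < ν) (hT : 0 < T)
    {Cf : ℝ≥0∞} (hCft : Cf ≠ ⊤) (hCf : ∀ t ∈ Icc 0 T, ∫⁻ x, ‖f t x‖ₑ ^ 2 ≤ Cf)
    {Pf : ℝ≥0∞} (hPft : Pf ≠ ⊤)
    (hπm : ∀ t ∈ Icc 0 T, AEStronglyMeasurable (forcePotential (f t)) volume)
    (hπ : ∀ t ∈ Icc 0 T, ∫⁻ x, ‖forcePotential (f t) x‖ₑ ^ 2 ≤ Pf)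
    {A : ℝ≥0∞} (hAt : A ≠ ⊤) (hA : ∀ t ∈ Icc 0 T, ∫⁻ x, ‖u t x‖ₑ ^ 2 ≤ A) :
    (∫⁻ τ in Ioo 0 T, ∫⁻ x, ENNReal.ofReal (frobeniusNormSq (fderiv ℝ (u τ) x)) < ⊤) ∧
      ∀ {s t : ℝ}, 0 ≤ s → s ≤ t → t ≤ T → VectorCalculus.kineticEnergy (u t) +
        ν * (∫⁻ τ in Ioo s t, ∫⁻ x, ENNReal.ofReal (frobeniusNormSq (fderiv ℝ (u τ) x))).toReal =
        VectorCalculus.kineticEnergy (u s) + ∫ τ in Ioo s t, ∫ x, ⟪f τ x, u τ x⟫ := by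
  have hgrad := h.lintegral_gradient_lt_top_forced hP tao2011_pressureTerm_estimate_holds hν hT hCft
    hCf hPft hπm hπ hAt hA
  exact ⟨hgrad, fun hs hst ht => h.energyEq_of_finiteEnergy_forced_ae hP
    tao2011_pressureTerm_estimate_holds hν hT hCft hCf hPft hπm hπ hAt hA hgrad
    (h.lintegral_enorm_pow_three_lt_top_forced hAt hA hgrad) hs hst ht⟩

end EnergyClass

end Literature.Analysis.FluidPDE

end
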